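import Summits.QuantumFields.YangMills.Theses.ConvexGribovBody
import Literature.MathematicalPhysics.QuantumFieldTheory.LatticeGaugeProofs
import Literature.MathematicalPhysics.QuantumLattice.GaugeGroupsProofs
import Literature.MathematicalPhysics.QuantumLattice.SU2Haar

/-!
# Disproof of `CovarianceBound` — findings (standing disprover, crux `stmt-QuantumFields-8780`, cycle 1, v2)

Crux: `Summit.QuantumFields.YangMills.Theses.ConvexGribovBody.CovarianceBound` — ∀ compact simple `G`, ∀
faithful unitary `r`, ∃ β₀ ∀ β ≥ β₀ ∃ D, S₀ ∀ S ≥ S₀ ∀ spatial momentum `p` (0 included):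
`∫ sup_{h ∈ argmin coul(U,·)} cov(U,h,p) dμ_{Wilson, β, (2S+1)⁴} ≤ D`, `cov(U,h,p) = L⁻³ Σ_j ‖Â_j(p)‖²_F`,
`A_j(y) = ½(ρ(U^h_{(0,y),j}) − ρ(U^h_{(0,y),j})ᴴ)`, `L = 2S+1`.

VERDICT (cycle 1): NO KILL of the crux. It is a faithful formalisation of the Gribov–Zwanziger infrared
statement "the minimal-Coulomb-gauge equal-time gluon propagator is bounded uniformly in the volume at fixed
weak coupling" — an OPEN problem for every non-abelian `G`, supported (not proved) by lattice numerics
(SU(2): Burgio–Quandt–Reinhardt arXiv:0807.3291, Gribov form, volume-stable; Cucchieri–Zwanziger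
hep-lat/0008026: `D^tr(0) ∝ L^{-0.5}` decreasing). No junk model exists at the Lean level (§C). What this file
delivers instead — everything below is sorry-free except the single documented `U(1)` near-miss:

* §A (proposed as `Theorems/CovarianceBound/Negative/FalseWithoutMinimalitySetup.lean` p99851 +
  `FalseWithoutMinimality.lean`): **the argmin restriction is load-bearing** —
  `not_covarianceBoundWithoutMinimality`. With the supremum over ALL gauge transformations the statement
  fails for `SU(2)` fundamental at EVERY `β` and EVERY `S ≥ 1`, configuration by configuration: the twisted
  axial gauge `hOf U` makes `cov(U, hOf U, 0) ≥ L(L−2)² ≥ 2S+1`.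
* §A′ (proposed as `Negative/SU2Angle.lean`, `ToronMinimiser.lean`, `ToronTight.lean`): **a CERTIFIED point of
  the fundamental modular region and `p = 0` tightness** — the spread toron `toron S` (every direction-1 link
  `ω = diag(e^{iπ/L}, e^{−iπ/L})`) has `h = 1` as an ABSOLUTE minimiser of the slice Coulomb functional
  (`coul_toron_one_le`, via the rotation-angle triangle inequality on `SU(2) ≅ S³` and concavity of `cos`),
  and there `cov(toron S, 1, 0) ≥ 4(2S+1)` (`le_cov_toron`, exactly `2L³ sin²(π/L) ≈ 2π²L`). Hence
  `toron_tight` (cycle-1 near-miss, now CLOSED) and **the configuration-wise strengthening of the crux is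
  FALSE** (`not_covarianceBoundPointwise`).
  Consequences for provers: (i) minimality must be used QUANTITATIVELY at `p = 0`; first-order stationarity
  is blind to the constant mode; (ii) even on the fundamental modular region the `p = 0` integrand is `≍ L`
  configuration-wise (Zwanziger's `O(L)` winding bound is attained), so the last factor `L` is the MEASURE's
  to supply — every proof at `p = 0` averages over `U`; (iii) the picked line's `stub_support` is sharp in
  `L` at `p = 0` and can now be evaluated exactly on a non-trivial family.
* §B `-- Targets`: the six stubs of the picked line `Lines/Sketch.lean` (support-slope × response-window),
  attacked on paper: stubs 2–5 are TRUE classical statements (the one matrix identity the mode reduction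
  needs is PROVED here: `froSum_sub_I_smul_eq`); stub 1 (`SupportBound`) survives with its non-`𝔤` /
  trace-part gap made precise (no certified-minimiser counterexample; on the toron family it holds with
  `C ≥ ½`); stub 6 (`ZeroFreeWindow`) is crux-strength and two NECESSARY features of the existential
  selection are derived (reflection-equivariance is forced; "polar" frames fail).
* §C load-bearing table for the crux's own hypotheses and the remaining near-miss `covBody_U1_false`
  (Guth / Fröhlich–Spencer deconfinement — the reason `IsCompactSimpleLieGroup` is there).

Nothing here edits the crux, the cards or the skeleton.
-/

set_option autoImplicit false

namespace Summit.QuantumFields.YangMills.Cruxes.CovarianceBound.Disproof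

open scoped Matrix ComplexConjugate Real
open MeasureTheory
open Literature.MathematicalPhysics.QuantumFieldTheory Literature.MathematicalPhysics.QuantumLattice

noncomputable section

/-! ## §A The argmin restriction is load-bearing (proposed: `…Theorems.CovarianceBound.Negative.FalseWithoutMinimality*`) -/

/-- `SU(2)` as a matrix group. -/
abbrev SU2 : Type := Matrix.specialUnitaryGroup (Fin 2) ℂ

/-- The twist `σ = diag(i, -i) ∈ SU(2)`. -/
def twist : SU2 :=
  ⟨!![Complex.I, 0; 0, -Complex.I], by
    rw [Matrix.mem_specialUnitaryGroup_iff, Matrix.mem_unitaryGroup_iff]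
    refine ⟨?_, ?_⟩
    · ext i j
      fin_cases i <;> fin_cases j <;>
        simp [Matrix.mul_apply, Fin.sum_univ_two, Matrix.star_apply]
    · simp [Matrix.det_fin_two]⟩

/-- The matrix of the twist. -/
@[simp] theorem twist_val : (twist : Matrix (Fin 2) (Fin 2) ℂ) = !![Complex.I, 0; 0, -Complex.I] := rfl

/-- The `(0,0)` entry of `σ⁻¹` is `−i`. -/
theorem twist_inv_val_zero_zero : ((twist⁻¹ : SU2) : Matrix (Fin 2) (Fin 2) ℂ) 0 0 = -Complex.I := by
  rw [← Matrix.star_eq_inv, Matrix.specialUnitaryGroup.coe_star, twist_val]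
  simp [Matrix.star_apply]

variable {S : ℕ}

/-- Twisted parallel transport along direction `1` of the time-zero slice: `Q 0 = 1`,
`Q (n+1) = σ · Q n · U((x with x₁ := n), 1)`. -/
def lineGauge (U : GaugeConfig 4 (2 * S + 1) SU2) (x : Site 4 (2 * S + 1)) : ℕ → SU2
  | 0 => 1
  | n + 1 => twist * lineGauge U x n * U (Function.update x 1 (n : ZMod (2 * S + 1)), 1)

/-- The adversarial gauge transformation `h_U(x) = Q_{x}((x 1).val)`. -/
def hOf (U : GaugeConfig 4 (2 * S + 1) SU2) (x : Site 4 (2 * S + 1)) : SU2 :=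
  lineGauge U x (x 1).val

/-- The twisted transport does not depend on the direction-`1` coordinate of its base point. -/
theorem lineGauge_update (U : GaugeConfig 4 (2 * S + 1) SU2) (x : Site 4 (2 * S + 1))
    (c : ZMod (2 * S + 1)) (n : ℕ) :
    lineGauge U (Function.update x 1 c) n = lineGauge U x n := by
  induction n with
  | zero => rfl
  | succ n ih => simp only [lineGauge, ih, Function.update_idem]

/-- Shifting a site in direction `1` updates its coordinate `1`. -/
theorem shift_one_eq_update (x : Site 4 (2 * S + 1)) :
    x.shift 1 = Function.update x 1 (x 1 + 1) := by
  funext k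
  by_cases hk : k = 1
  · subst hk; simp [Site.shift]
  · simp [Site.shift, hk]

/-- On every link `(x, 1)` that does not wrap around the torus, the twisted transport gauges the
link variable to `σ⁻¹`. -/
theorem gaugeTransform_hOf (U : GaugeConfig 4 (2 * S + 1) SU2) (x : Site 4 (2 * S + 1))
    (hx : (x 1).val + 1 < 2 * S + 1) :
    gaugeTransform (hOf U) U (x, 1) = twist⁻¹ := by
  have hval : (x 1 + 1).val = (x 1).val + 1 := by
    rw [ZMod.val_add, ZMod.val_one_eq_one_mod, Nat.add_mod_mod, Nat.mod_eq_of_lt hx]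
  simp only [gaugeTransform, hOf]
  rw [shift_one_eq_update, Function.update_self, hval]
  simp only [lineGauge]
  rw [Function.update_idem, ZMod.natCast_zmod_val, Function.update_eq_self, lineGauge_update]
  group


/-! ### The crux's integrand, verbatim, as named functions -/

/-- The crux's squared Frobenius norm `Σ_{a,b} ‖M a b‖²` (its `let fro`). -/
def fro {N : ℕ} (M : Matrix (Fin N) (Fin N) ℂ) : ℝ := ∑ a, ∑ b, ‖M a b‖ ^ 2

/-- The crux's equal-time covariance integrand `cov(U,h,p)` (its `let cov`, verbatim). -/
def cov {G : Type} [Group G] [TopologicalSpace G] (r : LatticeRep G) (S : ℕ)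
    (U : GaugeConfig 4 (2 * S + 1) G) (h : Site 4 (2 * S + 1) → G)
    (p : Fin 3 → ZMod (2 * S + 1)) : ℝ :=
  (∑ j : Fin 3, fro (∑ y : Fin 3 → ZMod (2 * S + 1),
    Complex.exp (-(2 * Real.pi * Complex.I * (∑ i : Fin 3, ((p i).val : ℂ) * ((y i).val : ℂ)) /
      (2 * S + 1 : ℂ))) •
      ((1 / 2 : ℂ) • (r.ρ (gaugeTransform h U (Fin.cons (0 : ZMod (2 * S + 1)) y, j.succ)) -
        (r.ρ (gaugeTransform h U (Fin.cons (0 : ZMod (2 * S + 1)) y, j.succ)))ᴴ)))) /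
    ((2 * S + 1 : ℝ) ^ 3)

/-- The fundamental lattice representation of `SU(2)`. -/
def su2Fund : LatticeRep SU2 :=
  ⟨2, fundamentalRep (Fin 2), continuous_fundamentalRep _, fundamentalRep_injective _,
    fundamentalRep_mem_unitaryGroup⟩

/-- `SU(2)` is a compact simple Lie group, unconditionally (tree:
`isSimpleCompactGroup_specialUnitaryGroup_holds`). -/
theorem isCompactSimpleLieGroup_SU2 : IsCompactSimpleLieGroup SU2 :=
  isCompactSimpleLieGroup_specialUnitaryGroup isSimpleCompactGroup_specialUnitaryGroup_holds le_rfl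

/-- At zero momentum every Fourier phase of the crux's integrand is `1`. -/
theorem phase_zero (y : Fin 3 → ZMod (2 * S + 1)) :
    Complex.exp (-(2 * Real.pi * Complex.I *
      (∑ i : Fin 3, (((0 : Fin 3 → ZMod (2 * S + 1)) i).val : ℂ) * ((y i).val : ℂ)) /
        (2 * S + 1 : ℂ))) = 1 := by
  simp

/-- Entries of `½(A - Aᴴ)` have norm at most `1` for unitary `A`. -/
theorem norm_half_sub_conjTranspose_apply_le {N : ℕ} {A : Matrix (Fin N) (Fin N) ℂ}
    (hA : A ∈ Matrix.unitaryGroup (Fin N) ℂ) (a b : Fin N) :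
    ‖((1 / 2 : ℂ) • (A - Aᴴ)) a b‖ ≤ 1 := by
  have h1 := entry_norm_bound_of_unitary hA a b
  have h2 := entry_norm_bound_of_unitary hA b a
  rw [Matrix.smul_apply, Matrix.sub_apply, Matrix.conjTranspose_apply, smul_eq_mul, norm_mul]
  have h3 : ‖A a b - star (A b a)‖ ≤ 2 := by
    refine (norm_sub_le _ _).trans ?_
    rw [norm_star]; linarith
  have : ‖(1 / 2 : ℂ)‖ = 1 / 2 := by simp
  rw [this]; linarith

/-- The `(0,0)` entry of `½(A - Aᴴ)` is `i · Im (A 0 0)`. -/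
theorem half_sub_conjTranspose_apply_zero {N : ℕ} (A : Matrix (Fin (N + 1)) (Fin (N + 1)) ℂ) :
    ((1 / 2 : ℂ) • (A - Aᴴ)) 0 0 = Complex.I * ((A 0 0).im : ℂ) := by
  rw [Matrix.smul_apply, Matrix.sub_apply, Matrix.conjTranspose_apply, smul_eq_mul]
  apply Complex.ext <;> simp; ring

/-- Crude upper bound for the zero-momentum integrand over ALL gauge transformations:
`cov(U,h,0) ≤ 12 · (2S+1)⁶` (used only for `BddAbove` / integrability). -/
theorem cov_zero_le (U : GaugeConfig 4 (2 * S + 1) SU2) (h : Site 4 (2 * S + 1) → SU2) :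
    cov su2Fund S U h 0 ≤ 12 * ((2 * S + 1 : ℝ) ^ 3) ^ 2 := by
  unfold cov
  have hL : (1 : ℝ) ≤ (2 * S + 1 : ℝ) ^ 3 := one_le_pow₀ (by norm_cast; omega)
  have hcard : (Fintype.card (Fin 3 → ZMod (2 * S + 1)) : ℝ) = (2 * S + 1 : ℝ) ^ 3 := by
    rw [Fintype.card_fun, ZMod.card, Fintype.card_fin]; push_cast; ring
  -- each Frobenius term is at most 4 · L⁶
  have hterm : ∀ j : Fin 3, fro (∑ y : Fin 3 → ZMod (2 * S + 1),
      Complex.exp (-(2 * Real.pi * Complex.I *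
        (∑ i : Fin 3, (((0 : Fin 3 → ZMod (2 * S + 1)) i).val : ℂ) * ((y i).val : ℂ)) /
          (2 * S + 1 : ℂ))) •
        ((1 / 2 : ℂ) • (su2Fund.ρ (gaugeTransform h U (Fin.cons (0 : ZMod (2 * S + 1)) y, j.succ)) -
          (su2Fund.ρ (gaugeTransform h U (Fin.cons (0 : ZMod (2 * S + 1)) y, j.succ)))ᴴ))) ≤
      4 * ((2 * S + 1 : ℝ) ^ 3) ^ 2 := by
    intro j
    simp only [phase_zero, one_smul]
    unfold fro
    have hentry : ∀ a b : Fin 2, ‖(∑ y : Fin 3 → ZMod (2 * S + 1),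
        ((1 / 2 : ℂ) • (su2Fund.ρ (gaugeTransform h U (Fin.cons (0 : ZMod (2 * S + 1)) y, j.succ)) -
          (su2Fund.ρ (gaugeTransform h U (Fin.cons (0 : ZMod (2 * S + 1)) y, j.succ)))ᴴ))) a b‖ ≤
        (2 * S + 1 : ℝ) ^ 3 := by
      intro a b
      rw [Matrix.sum_apply]
      refine (norm_sum_le _ _).trans ?_
      calc ∑ y : Fin 3 → ZMod (2 * S + 1), ‖((1 / 2 : ℂ) •
              (su2Fund.ρ (gaugeTransform h U (Fin.cons (0 : ZMod (2 * S + 1)) y, j.succ)) -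
                (su2Fund.ρ (gaugeTransform h U (Fin.cons (0 : ZMod (2 * S + 1)) y, j.succ)))ᴴ)) a b‖
          ≤ ∑ _y : Fin 3 → ZMod (2 * S + 1), (1 : ℝ) :=
            Finset.sum_le_sum fun y _ =>
              norm_half_sub_conjTranspose_apply_le (su2Fund.mem_unitary _) a b
        _ = (2 * S + 1 : ℝ) ^ 3 := by
            rw [Finset.sum_const, Finset.card_univ, nsmul_eq_mul, mul_one, hcard]
    have hsq : ∀ a b : Fin 2, ‖(∑ y : Fin 3 → ZMod (2 * S + 1),
        ((1 / 2 : ℂ) • (su2Fund.ρ (gaugeTransform h U (Fin.cons (0 : ZMod (2 * S + 1)) y, j.succ)) -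
          (su2Fund.ρ (gaugeTransform h U (Fin.cons (0 : ZMod (2 * S + 1)) y, j.succ)))ᴴ))) a b‖ ^ 2 ≤
        ((2 * S + 1 : ℝ) ^ 3) ^ 2 := fun a b =>
      pow_le_pow_left₀ (norm_nonneg _) (hentry a b) 2
    calc _ ≤ ∑ _a : Fin 2, ∑ _b : Fin 2, ((2 * S + 1 : ℝ) ^ 3) ^ 2 :=
          Finset.sum_le_sum fun a _ => Finset.sum_le_sum fun b _ => hsq a b
      _ = 4 * ((2 * S + 1 : ℝ) ^ 3) ^ 2 := by simp; ring
  have hsum : (∑ j : Fin 3, fro (∑ y : Fin 3 → ZMod (2 * S + 1),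
      Complex.exp (-(2 * Real.pi * Complex.I *
        (∑ i : Fin 3, (((0 : Fin 3 → ZMod (2 * S + 1)) i).val : ℂ) * ((y i).val : ℂ)) /
          (2 * S + 1 : ℂ))) •
        ((1 / 2 : ℂ) • (su2Fund.ρ (gaugeTransform h U (Fin.cons (0 : ZMod (2 * S + 1)) y, j.succ)) -
          (su2Fund.ρ (gaugeTransform h U (Fin.cons (0 : ZMod (2 * S + 1)) y, j.succ)))ᴴ)))) ≤
      12 * ((2 * S + 1 : ℝ) ^ 3) ^ 2 := by
    calc _ ≤ ∑ _j : Fin 3, 4 * ((2 * S + 1 : ℝ) ^ 3) ^ 2 := Finset.sum_le_sum fun j _ => hterm j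
      _ = 12 * ((2 * S + 1 : ℝ) ^ 3) ^ 2 := by simp; ring
  have hnn : (0 : ℝ) ≤ 12 * ((2 * S + 1 : ℝ) ^ 3) ^ 2 := by positivity
  calc _ ≤ 12 * ((2 * S + 1 : ℝ) ^ 3) ^ 2 / (2 * S + 1 : ℝ) ^ 3 :=
        div_le_div_of_nonneg_right hsum (by positivity)
    _ ≤ 12 * ((2 * S + 1 : ℝ) ^ 3) ^ 2 := div_le_self hnn hL


/-- The fundamental representation is the underlying matrix. -/
@[simp] theorem su2Fund_ρ (g : SU2) : su2Fund.ρ g = (g : Matrix (Fin 2) (Fin 2) ℂ) := rfl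

/-- `Fin.cons 0 y` has first spatial coordinate `y 0`. -/
theorem cons_apply_one (y : Fin 3 → ZMod (2 * S + 1)) :
    (Fin.cons (0 : ZMod (2 * S + 1)) y : Site 4 (2 * S + 1)) 1 = y 0 := rfl

/-- The number of wrap-around sites (`y 0 = L - 1`) is at most `L²`. -/
theorem card_bad_le :
    ((Finset.univ.filter fun y : Fin 3 → ZMod (2 * S + 1) => ¬ ((y 0).val + 1 < 2 * S + 1)).card
      ≤ (2 * S + 1) ^ 2) := by
  have hcard : Fintype.card (Fin 2 → ZMod (2 * S + 1)) = (2 * S + 1) ^ 2 := by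
    rw [Fintype.card_fun, ZMod.card, Fintype.card_fin]
  rw [← hcard, ← Finset.card_univ]
  refine Finset.card_le_card_of_injOn (fun y => Fin.tail y) (fun _ _ => by simp) ?_
  intro y hy y' hy' h
  simp only [Finset.coe_filter, Finset.mem_univ, true_and, Set.mem_setOf_eq, not_lt] at hy hy'
  have h0 : y 0 = y' 0 := by
    apply ZMod.val_injective
    have := ZMod.val_lt (y 0); have := ZMod.val_lt (y' 0); omega
  rw [← Fin.cons_self_tail y, ← Fin.cons_self_tail y', h0]
  exact congrArg _ h

/-- The imaginary parts of the `(0,0)` entries of the adversarially gauged direction-`1` links sum to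
at most `-(L³ - 2L²)`: `-1` on every non-wrapping link, at most `1` on the `≤ L²` wrapping ones. -/
theorem sum_im_le (U : GaugeConfig 4 (2 * S + 1) SU2) :
    ∑ y : Fin 3 → ZMod (2 * S + 1),
      (((gaugeTransform (hOf U) U (Fin.cons (0 : ZMod (2 * S + 1)) y, (0 : Fin 3).succ) : SU2) :
        Matrix (Fin 2) (Fin 2) ℂ) 0 0).im
      ≤ -((2 * S + 1 : ℝ) ^ 3) + 2 * (2 * S + 1 : ℝ) ^ 2 := by
  have hgood : ∀ y : Fin 3 → ZMod (2 * S + 1), (y 0).val + 1 < 2 * S + 1 →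
      (((gaugeTransform (hOf U) U (Fin.cons (0 : ZMod (2 * S + 1)) y, (0 : Fin 3).succ) : SU2) :
        Matrix (Fin 2) (Fin 2) ℂ) 0 0).im = -1 := by
    intro y hy
    have h := gaugeTransform_hOf U (Fin.cons (0 : ZMod (2 * S + 1)) y) hy
    rw [show ((Fin.cons (0 : ZMod (2 * S + 1)) y, (0 : Fin 3).succ) : Edge 4 (2 * S + 1)) =
      (Fin.cons (0 : ZMod (2 * S + 1)) y, 1) from rfl, h, twist_inv_val_zero_zero]
    simp
  have hbad : ∀ y : Fin 3 → ZMod (2 * S + 1),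
      (((gaugeTransform (hOf U) U (Fin.cons (0 : ZMod (2 * S + 1)) y, (0 : Fin 3).succ) : SU2) :
        Matrix (Fin 2) (Fin 2) ℂ) 0 0).im ≤ 1 := fun y =>
    (Complex.im_le_norm _).trans
      (entry_norm_bound_of_unitary (gaugeTransform (hOf U) U _).prop.1 0 0)
  have hcardR : (Fintype.card (Fin 3 → ZMod (2 * S + 1)) : ℝ) = (2 * S + 1 : ℝ) ^ 3 := by
    rw [Fintype.card_fun, ZMod.card, Fintype.card_fin]; push_cast; ring
  have hbadR : (((Finset.univ.filter fun y : Fin 3 → ZMod (2 * S + 1) =>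
      ¬ ((y 0).val + 1 < 2 * S + 1)).card : ℕ) : ℝ) ≤ (2 * S + 1 : ℝ) ^ 2 := by
    exact_mod_cast card_bad_le (S := S)
  calc ∑ y : Fin 3 → ZMod (2 * S + 1),
        (((gaugeTransform (hOf U) U (Fin.cons (0 : ZMod (2 * S + 1)) y, (0 : Fin 3).succ) : SU2) :
          Matrix (Fin 2) (Fin 2) ℂ) 0 0).im
      ≤ ∑ y : Fin 3 → ZMod (2 * S + 1),
          ((-1 : ℝ) + 2 * (if ¬ ((y 0).val + 1 < 2 * S + 1) then (1 : ℝ) else 0)) := by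
        refine Finset.sum_le_sum fun y _ => ?_
        by_cases hy : (y 0).val + 1 < 2 * S + 1
        · rw [hgood y hy]; simp [hy]
        · simp only [hy, not_false_eq_true, ↓reduceIte]; linarith [hbad y]
    _ = -((2 * S + 1 : ℝ) ^ 3) + 2 * (((Finset.univ.filter fun y : Fin 3 → ZMod (2 * S + 1) =>
          ¬ ((y 0).val + 1 < 2 * S + 1)).card : ℕ) : ℝ) := by
        rw [Finset.sum_add_distrib, Finset.sum_const, Finset.card_univ, nsmul_eq_mul, hcardR,
          ← Finset.mul_sum, Finset.sum_boole]
        simp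
    _ ≤ -((2 * S + 1 : ℝ) ^ 3) + 2 * (2 * S + 1 : ℝ) ^ 2 := by linarith

/-- **Configuration-wise lower bound.** For EVERY configuration `U`, the zero-momentum integrand at
the adversarial gauge transformation `h_U` is at least `2S + 1` (in fact `≥ L (L-2)²`, `L = 2S+1 ≥ 3`). -/
theorem le_cov_hOf (hS : 1 ≤ S) (U : GaugeConfig 4 (2 * S + 1) SU2) :
    (2 * S + 1 : ℝ) ≤ cov su2Fund S U (hOf U) 0 := by
  unfold cov
  simp only [phase_zero, one_smul, su2Fund_ρ]
  have hL3 : (3 : ℝ) ≤ (2 * S + 1 : ℝ) := by norm_cast; omega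
  -- the j = 0 term, entry (0,0)
  set M : Matrix (Fin 2) (Fin 2) ℂ := ∑ y : Fin 3 → ZMod (2 * S + 1),
    (1 / 2 : ℂ) • (((gaugeTransform (hOf U) U (Fin.cons (0 : ZMod (2 * S + 1)) y, (0 : Fin 3).succ) :
      SU2) : Matrix (Fin 2) (Fin 2) ℂ) -
      (((gaugeTransform (hOf U) U (Fin.cons (0 : ZMod (2 * S + 1)) y, (0 : Fin 3).succ) : SU2) :
        Matrix (Fin 2) (Fin 2) ℂ))ᴴ) with hM
  have hfro_nonneg : ∀ j : Fin 3, 0 ≤ fro (∑ y : Fin 3 → ZMod (2 * S + 1),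
      (1 / 2 : ℂ) • (((gaugeTransform (hOf U) U (Fin.cons (0 : ZMod (2 * S + 1)) y, j.succ) : SU2) :
        Matrix (Fin 2) (Fin 2) ℂ) -
        (((gaugeTransform (hOf U) U (Fin.cons (0 : ZMod (2 * S + 1)) y, j.succ) : SU2) :
          Matrix (Fin 2) (Fin 2) ℂ))ᴴ)) := fun j => by
    unfold fro; positivity
  have hsum : fro M ≤ ∑ j : Fin 3, fro (∑ y : Fin 3 → ZMod (2 * S + 1),
      (1 / 2 : ℂ) • (((gaugeTransform (hOf U) U (Fin.cons (0 : ZMod (2 * S + 1)) y, j.succ) : SU2) :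
        Matrix (Fin 2) (Fin 2) ℂ) -
        (((gaugeTransform (hOf U) U (Fin.cons (0 : ZMod (2 * S + 1)) y, j.succ) : SU2) :
          Matrix (Fin 2) (Fin 2) ℂ))ᴴ)) :=
    Finset.single_le_sum (f := fun j : Fin 3 => fro (∑ y : Fin 3 → ZMod (2 * S + 1),
      (1 / 2 : ℂ) • (((gaugeTransform (hOf U) U (Fin.cons (0 : ZMod (2 * S + 1)) y, j.succ) : SU2) :
        Matrix (Fin 2) (Fin 2) ℂ) -
        (((gaugeTransform (hOf U) U (Fin.cons (0 : ZMod (2 * S + 1)) y, j.succ) : SU2) :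
          Matrix (Fin 2) (Fin 2) ℂ))ᴴ))) (fun j _ => hfro_nonneg j) (Finset.mem_univ 0)
  have hentry : ‖M 0 0‖ ^ 2 ≤ fro M := by
    unfold fro
    calc ‖M 0 0‖ ^ 2 ≤ ∑ b : Fin 2, ‖M 0 b‖ ^ 2 :=
          Finset.single_le_sum (f := fun b : Fin 2 => ‖M 0 b‖ ^ 2) (fun b _ => by positivity)
            (Finset.mem_univ 0)
      _ ≤ ∑ a : Fin 2, ∑ b : Fin 2, ‖M a b‖ ^ 2 :=
          Finset.single_le_sum (f := fun a : Fin 2 => ∑ b : Fin 2, ‖M a b‖ ^ 2)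
            (fun a _ => by positivity) (Finset.mem_univ 0)
  have hM00 : M 0 0 = Complex.I * ((∑ y : Fin 3 → ZMod (2 * S + 1),
      (((gaugeTransform (hOf U) U (Fin.cons (0 : ZMod (2 * S + 1)) y, (0 : Fin 3).succ) : SU2) :
        Matrix (Fin 2) (Fin 2) ℂ) 0 0).im : ℝ) : ℂ) := by
    rw [hM, Matrix.sum_apply]
    simp_rw [half_sub_conjTranspose_apply_zero]
    rw [← Finset.mul_sum, Complex.ofReal_sum]
  have hnorm : ‖M 0 0‖ = |∑ y : Fin 3 → ZMod (2 * S + 1),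
      (((gaugeTransform (hOf U) U (Fin.cons (0 : ZMod (2 * S + 1)) y, (0 : Fin 3).succ) : SU2) :
        Matrix (Fin 2) (Fin 2) ℂ) 0 0).im| := by
    rw [hM00, norm_mul, Complex.norm_I, one_mul, Complex.norm_real, Real.norm_eq_abs]
  have him := sum_im_le U
  have habs : (2 * S + 1 : ℝ) ^ 3 - 2 * (2 * S + 1 : ℝ) ^ 2 ≤ ‖M 0 0‖ := by
    rw [hnorm]
    refine le_trans ?_ (neg_le_abs _)
    linarith
  have hpos : (0 : ℝ) ≤ (2 * S + 1 : ℝ) ^ 3 - 2 * (2 * S + 1 : ℝ) ^ 2 := by nlinarith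
  have hsq : ((2 * S + 1 : ℝ) ^ 3 - 2 * (2 * S + 1 : ℝ) ^ 2) ^ 2 ≤ fro M :=
    (pow_le_pow_left₀ hpos habs 2).trans hentry
  have key : ∀ L : ℝ, 3 ≤ L → L * L ^ 3 ≤ (L ^ 3 - 2 * L ^ 2) ^ 2 := by
    intro L hL
    have h1 : 1 ≤ (L - 2) ^ 2 := by nlinarith
    have h4 : 0 ≤ L ^ 4 := by positivity
    calc L * L ^ 3 = L ^ 4 * 1 := by ring
      _ ≤ L ^ 4 * (L - 2) ^ 2 := mul_le_mul_of_nonneg_left h1 h4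
      _ = (L ^ 3 - 2 * L ^ 2) ^ 2 := by ring
  rw [le_div_iff₀ (by positivity)]
  exact (key _ hL3).trans (hsq.trans hsum)




/-! ### Measure side: the zero-momentum all-gauges supremum is measurable, bounded, and `≥ 2S+1` -/

/-- For a fixed gauge transformation the zero-momentum integrand is continuous in the configuration. -/
theorem continuous_cov_zero (h : Site 4 (2 * S + 1) → SU2) :
    Continuous fun U : GaugeConfig 4 (2 * S + 1) SU2 => cov su2Fund S U h 0 := by
  unfold cov fro
  simp only [phase_zero, one_smul, su2Fund_ρ]
  have hgt : ∀ e : Edge 4 (2 * S + 1), Continuous fun U : GaugeConfig 4 (2 * S + 1) SU2 =>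
      ((gaugeTransform h U e : SU2) : Matrix (Fin 2) (Fin 2) ℂ) := fun e => by
    unfold gaugeTransform
    exact continuous_subtype_val.comp
      ((continuous_const.mul (continuous_apply e)).mul continuous_const)
  have hmat : ∀ j : Fin 3, Continuous fun U : GaugeConfig 4 (2 * S + 1) SU2 =>
      ∑ y : Fin 3 → ZMod (2 * S + 1), (1 / 2 : ℂ) •
        (((gaugeTransform h U (Fin.cons (0 : ZMod (2 * S + 1)) y, j.succ) : SU2) :
          Matrix (Fin 2) (Fin 2) ℂ) -
          (((gaugeTransform h U (Fin.cons (0 : ZMod (2 * S + 1)) y, j.succ) : SU2) :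
            Matrix (Fin 2) (Fin 2) ℂ))ᴴ) := fun j => by
    refine continuous_finsetSum _ fun y _ => ?_
    have h1 := hgt (Fin.cons (0 : ZMod (2 * S + 1)) y, j.succ)
    exact (h1.sub h1.matrix_conjTranspose).const_smul (1 / 2 : ℂ)
  exact (continuous_finsetSum _ fun j _ => continuous_finsetSum _ fun a _ =>
    continuous_finsetSum _ fun b _ => ((hmat j).matrix_elem a b).norm.pow 2).div_const _

/-- The all-gauges family of zero-momentum integrands is bounded above (by `12 L⁶`). -/
theorem bddAbove_cov_zero (U : GaugeConfig 4 (2 * S + 1) SU2) :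
    BddAbove (Set.range fun h : Site 4 (2 * S + 1) → SU2 => cov su2Fund S U h 0) :=
  ⟨12 * ((2 * S + 1 : ℝ) ^ 3) ^ 2, by rintro _ ⟨h, rfl⟩; exact cov_zero_le U h⟩

/-- The all-gauges supremum is lower semicontinuous, hence Borel measurable (`G^{E}` is second
countable, so the product σ-algebra is the Borel one). -/
theorem measurable_iSup_cov_zero :
    Measurable fun U : GaugeConfig 4 (2 * S + 1) SU2 =>
      ⨆ h : Site 4 (2 * S + 1) → SU2, cov su2Fund S U h 0 :=
  (lowerSemicontinuous_ciSup (f := fun (h : Site 4 (2 * S + 1) → SU2)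
      (U : GaugeConfig 4 (2 * S + 1) SU2) => cov su2Fund S U h 0)
    bddAbove_cov_zero fun h => (continuous_cov_zero h).lowerSemicontinuous).measurable

/-- Upper bound `12 L⁶` for the all-gauges supremum. -/
theorem iSup_cov_zero_le (U : GaugeConfig 4 (2 * S + 1) SU2) :
    (⨆ h : Site 4 (2 * S + 1) → SU2, cov su2Fund S U h 0) ≤ 12 * ((2 * S + 1 : ℝ) ^ 3) ^ 2 :=
  ciSup_le fun h => cov_zero_le U h

/-- Lower bound `2S+1` for the all-gauges supremum, configuration-wise. -/
theorem le_iSup_cov_zero (hS : 1 ≤ S) (U : GaugeConfig 4 (2 * S + 1) SU2) :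
    (2 * S + 1 : ℝ) ≤ ⨆ h : Site 4 (2 * S + 1) → SU2, cov su2Fund S U h 0 :=
  (le_cov_hOf hS U).trans (le_ciSup (bddAbove_cov_zero U) (hOf U))

/-- **Measure-side lower bound.** For `SU(2)` in the fundamental representation, at EVERY coupling
`β` and on EVERY torus `(2S+1)⁴` with `S ≥ 1`, the Wilson expectation of the zero-momentum integrand
with the supremum taken over all gauge transformations is at least `2S + 1`. -/
theorem integral_iSup_cov_zero_ge (hS : 1 ≤ S) (β : ℝ) :
    (2 * S + 1 : ℝ) ≤ ∫ U, (⨆ h : Site 4 (2 * S + 1) → SU2, cov su2Fund S U h 0)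
      ∂(wilsonMeasure (d := 4) (L := 2 * S + 1) su2Fund.ρ β) := by
  haveI := isProbabilityMeasure_wilsonMeasure (d := 4) (L := 2 * S + 1) su2Fund.ρ
    su2Fund.continuous β
  have hint : Integrable (fun U : GaugeConfig 4 (2 * S + 1) SU2 =>
      ⨆ h : Site 4 (2 * S + 1) → SU2, cov su2Fund S U h 0)
      (wilsonMeasure (d := 4) (L := 2 * S + 1) su2Fund.ρ β) := by
    refine (integrable_const (12 * ((2 * S + 1 : ℝ) ^ 3) ^ 2)).mono'
      measurable_iSup_cov_zero.aestronglyMeasurable (ae_of_all _ fun U => ?_)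
    rw [Real.norm_eq_abs, abs_of_nonneg
      (le_trans (by positivity : (0 : ℝ) ≤ 2 * S + 1) (le_iSup_cov_zero hS U))]
    exact iSup_cov_zero_le U
  calc (2 * S + 1 : ℝ)
      = ∫ _U, (2 * S + 1 : ℝ) ∂(wilsonMeasure (d := 4) (L := 2 * S + 1) su2Fund.ρ β) := by
        rw [integral_const, probReal_univ, one_smul]
    _ ≤ _ := integral_mono (integrable_const _) hint fun U => le_iSup_cov_zero hS U

/-! ### The crux with minimality dropped, and its refutation -/

/-- `CovarianceBound` WITHOUT MINIMALITY: verbatim the crux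
`Summit.QuantumFields.YangMills.Theses.ConvexGribovBody.CovarianceBound` except that the supremum
inside the integral runs over ALL gauge transformations `h : Site → G` of the configuration instead
of the absolute minimisers `{h // ∀ h', coul U h ≤ coul U h'}` of the slice Coulomb functional (the
then-unused `let coul` is omitted). -/
def CovarianceBoundWithoutMinimality : Prop :=
  ∀ (G : Type) [Group G] [TopologicalSpace G] [IsTopologicalGroup G] [CompactSpace G] [MeasurableSpace G] [BorelSpace G], IsCompactSimpleLieGroup G → ∀ r : LatticeRep G, ∃ β₀ : ℝ, ∀ β : ℝ, β₀ ≤ β → ∃ D : ℝ, 0 < D ∧ ∃ S₀ : ℕ, ∀ S : ℕ, S₀ ≤ S → let μ := wilsonMeasure (d := 4) (L := 2 * S + 1) r.ρ β; let fro : Matrix (Fin r.N) (Fin r.N) ℂ → ℝ := fun M => ∑ a, ∑ b, ‖M a b‖ ^ 2; let cov : GaugeConfig 4 (2 * S + 1) G → (Site 4 (2 * S + 1) → G) → (Fin 3 → ZMod (2 * S + 1)) → ℝ := fun U h p => (∑ j : Fin 3, fro (∑ y : Fin 3 → ZMod (2 * S + 1), Complex.exp (-(2 * Real.pi * Complex.I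 * (∑ i : Fin 3, ((p i).val : ℂ) * ((y i).val : ℂ)) / (2 * S + 1 : ℂ))) • ((1 / 2 : ℂ) • (r.ρ (gaugeTransform h U (Fin.cons (0 : ZMod (2 * S + 1)) y, j.succ)) - (r.ρ (gaugeTransform h U (Fin.cons (0 : ZMod (2 * S + 1)) y, j.succ)))ᴴ)))) / ((2 * S + 1 : ℝ) ^ 3); ∀ p : Fin 3 → ZMod (2 * S + 1), ∫ U, (⨆ h : Site 4 (2 * S + 1) → G, cov U h p) ∂μ ≤ D

/-- **`CovarianceBound` is false without minimality** — any proof of the crux must use the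
minimising property of `h` quantitatively, already at zero momentum: for `G = SU(2)` in the
fundamental representation the all-gauges zero-momentum expectation is `≥ 2S+1` at every `β`
(`integral_iSup_cov_zero_ge`), so no volume-uniform `D` exists. -/
theorem not_covarianceBoundWithoutMinimality : ¬ CovarianceBoundWithoutMinimality := by
  intro H
  obtain ⟨β₀, hβ⟩ := H SU2 isCompactSimpleLieGroup_SU2 su2Fund
  obtain ⟨D, -, S₀, hS₀⟩ := hβ β₀ le_rfl
  set S : ℕ := max (max S₀ 1) ⌈D⌉₊ with hSdef
  have hS₀S : S₀ ≤ S := le_trans (le_max_left _ _) (le_max_left _ _)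
  have h1S : 1 ≤ S := le_trans (le_max_right _ _) (le_max_left _ _)
  have hDS : D ≤ (S : ℝ) := le_trans (Nat.le_ceil D) (by exact_mod_cast le_max_right _ _)
  have h := hS₀ S hS₀S
  have h0 : ∫ U, (⨆ h : Site 4 (2 * S + 1) → SU2, cov su2Fund S U h 0)
      ∂(wilsonMeasure (d := 4) (L := 2 * S + 1) su2Fund.ρ β₀) ≤ D := by
    simpa [cov, fro] using h 0
  have := integral_iSup_cov_zero_ge h1S β₀
  linarith

/-! ## §A′ A certified absolute Coulomb minimiser (spread toron); `p = 0` tightness; the configuration-wise strengthening is false (proposed: `Negative/SU2Angle`, `ToronMinimiser`, `ToronTight`) -/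



/-- The rotation half-angle `φ(V) = arccos (Re V₀₀) ∈ [0, π]` of `V ∈ SU(2)` (`Re tr V = 2 cos φ(V)`):
the bi-invariant geodesic distance from `1` on `SU(2) ≅ S³`. -/
def ang (V : Matrix.specialUnitaryGroup (Fin 2) ℂ) : ℝ := Real.arccos ((V : Matrix (Fin 2) (Fin 2) ℂ) 0 0).re

/-- First-row unit norm: `(Re V₀₀)² + (Im V₀₀)² + (Re V₀₁)² + (Im V₀₁)² = 1`. -/
theorem su2_row_normSq (V : Matrix.specialUnitaryGroup (Fin 2) ℂ) :
    ((V : Matrix (Fin 2) (Fin 2) ℂ) 0 0).re ^ 2 + ((V : Matrix (Fin 2) (Fin 2) ℂ) 0 0).im ^ 2 +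
      ((V : Matrix (Fin 2) (Fin 2) ℂ) 0 1).re ^ 2 + ((V : Matrix (Fin 2) (Fin 2) ℂ) 0 1).im ^ 2 = 1 := by
  have h := normSq_su2Quat V
  simp only [su2Quat, Quaternion.normSq_def'] at h
  linarith [h]

/-- `Re V₀₀ ≤ 1`. -/
theorem re_le_one (V : Matrix.specialUnitaryGroup (Fin 2) ℂ) : ((V : Matrix (Fin 2) (Fin 2) ℂ) 0 0).re ≤ 1 := by
  nlinarith [su2_row_normSq V, sq_nonneg (((V : Matrix (Fin 2) (Fin 2) ℂ) 0 0).re - 1)]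

/-- `−1 ≤ Re V₀₀`. -/
theorem neg_one_le_re (V : Matrix.specialUnitaryGroup (Fin 2) ℂ) : -1 ≤ ((V : Matrix (Fin 2) (Fin 2) ℂ) 0 0).re := by
  nlinarith [su2_row_normSq V, sq_nonneg (((V : Matrix (Fin 2) (Fin 2) ℂ) 0 0).re + 1)]

/-- `0 ≤ φ(V)`. -/
theorem ang_nonneg (V : Matrix.specialUnitaryGroup (Fin 2) ℂ) : 0 ≤ ang V := Real.arccos_nonneg _

/-- `φ(V) ≤ π`. -/
theorem ang_le_pi (V : Matrix.specialUnitaryGroup (Fin 2) ℂ) : ang V ≤ π := Real.arccos_le_pi _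

/-- `cos φ(V) = Re V₀₀`. -/
theorem cos_ang (V : Matrix.specialUnitaryGroup (Fin 2) ℂ) :
    Real.cos (ang V) = ((V : Matrix (Fin 2) (Fin 2) ℂ) 0 0).re :=
  Real.cos_arccos (neg_one_le_re V) (re_le_one V)

/-- `sin φ(V) = √(1 − (Re V₀₀)²)`. -/
theorem sin_ang (V : Matrix.specialUnitaryGroup (Fin 2) ℂ) :
    Real.sin (ang V) = Real.sqrt (1 - ((V : Matrix (Fin 2) (Fin 2) ℂ) 0 0).re ^ 2) :=
  Real.sin_arccos _

/-- The `(0,0)` entry of a product in `SU(2)`. -/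
theorem mul_apply_zero_zero (V W : Matrix.specialUnitaryGroup (Fin 2) ℂ) :
    ((V * W : Matrix.specialUnitaryGroup (Fin 2) ℂ) : Matrix (Fin 2) (Fin 2) ℂ) 0 0 =
      (V : Matrix (Fin 2) (Fin 2) ℂ) 0 0 * (W : Matrix (Fin 2) (Fin 2) ℂ) 0 0 -
        (V : Matrix (Fin 2) (Fin 2) ℂ) 0 1 * conj ((W : Matrix (Fin 2) (Fin 2) ℂ) 0 1) := by
  rw [show ((V * W : Matrix.specialUnitaryGroup (Fin 2) ℂ) : Matrix (Fin 2) (Fin 2) ℂ) =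
      (V : Matrix (Fin 2) (Fin 2) ℂ) * W from rfl, Matrix.mul_apply, Fin.sum_univ_two, su2_apply_10]
  ring

/-- **Triangle inequality for the angle** in cosine form: `Re (VW)₀₀ ≥ cos (min π (φ V + φ W))`. -/
theorem cos_min_le_re_mul (V W : Matrix.specialUnitaryGroup (Fin 2) ℂ) :
    Real.cos (min π (ang V + ang W)) ≤
      (((V * W : Matrix.specialUnitaryGroup (Fin 2) ℂ) : Matrix (Fin 2) (Fin 2) ℂ) 0 0).re := by
  by_cases hle : ang V + ang W ≤ π
  · rw [min_eq_right hle, Real.cos_add, cos_ang, cos_ang, sin_ang, sin_ang, mul_apply_zero_zero]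
    set a := (V : Matrix (Fin 2) (Fin 2) ℂ) 0 0
    set b := (V : Matrix (Fin 2) (Fin 2) ℂ) 0 1
    set c := (W : Matrix (Fin 2) (Fin 2) ℂ) 0 0
    set d := (W : Matrix (Fin 2) (Fin 2) ℂ) 0 1
    have hV : a.re ^ 2 + a.im ^ 2 + b.re ^ 2 + b.im ^ 2 = 1 := su2_row_normSq V
    have hW : c.re ^ 2 + c.im ^ 2 + d.re ^ 2 + d.im ^ 2 = 1 := su2_row_normSq W
    have hre : (a * c - b * conj d).re = a.re * c.re - (a.im * c.im + b.re * d.re + b.im * d.im) := by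
      simp [Complex.mul_re, Complex.sub_re]; ring
    rw [hre]
    -- Cauchy–Schwarz in ℝ³
    have hp : 1 - a.re ^ 2 = a.im ^ 2 + b.re ^ 2 + b.im ^ 2 := by linarith
    have hq : 1 - c.re ^ 2 = c.im ^ 2 + d.re ^ 2 + d.im ^ 2 := by linarith
    have hcs : (a.im * c.im + b.re * d.re + b.im * d.im) ^ 2 ≤
        (a.im ^ 2 + b.re ^ 2 + b.im ^ 2) * (c.im ^ 2 + d.re ^ 2 + d.im ^ 2) := by
      nlinarith [sq_nonneg (a.im * d.re - b.re * c.im), sq_nonneg (a.im * d.im - b.im * c.im),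
        sq_nonneg (b.re * d.im - b.im * d.re)]
    have hsqrt : a.im * c.im + b.re * d.re + b.im * d.im ≤
        Real.sqrt (1 - a.re ^ 2) * Real.sqrt (1 - c.re ^ 2) := by
      rw [← Real.sqrt_mul (by rw [hp]; positivity), hp, hq]
      exact Real.le_sqrt_of_sq_le hcs
    linarith
  · rw [min_eq_left (le_of_lt (not_le.mp hle)), Real.cos_pi]
    exact neg_one_le_re (V * W)

/-- The angle is subadditive up to the cap `π`: `φ(VW) ≤ min π (φ V + φ W)`. -/
theorem ang_mul_le (V W : Matrix.specialUnitaryGroup (Fin 2) ℂ) : ang (V * W) ≤ min π (ang V + ang W) := by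
  have h := cos_min_le_re_mul V W
  have hmin0 : 0 ≤ min π (ang V + ang W) := le_min Real.pi_pos.le (add_nonneg (ang_nonneg V) (ang_nonneg W))
  have hminπ : min π (ang V + ang W) ≤ π := min_le_left _ _
  calc ang (V * W)
      = Real.arccos (((V * W : Matrix.specialUnitaryGroup (Fin 2) ℂ) : Matrix (Fin 2) (Fin 2) ℂ) 0 0).re := rfl
    _ ≤ Real.arccos (Real.cos (min π (ang V + ang W))) := Real.antitone_arccos h
    _ = min π (ang V + ang W) := Real.arccos_cos hmin0 hminπ

/-- `φ(1) = 0`. -/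
theorem ang_one : ang 1 = 0 := by
  simp [ang]

/-- Ordered product `V 0 * V 1 * ⋯ * V (k-1)`. -/
def oprod (V : ℕ → Matrix.specialUnitaryGroup (Fin 2) ℂ) : ℕ → Matrix.specialUnitaryGroup (Fin 2) ℂ
  | 0 => 1
  | k + 1 => oprod V k * V k

/-- **Subadditivity along a chain**: `φ(V₀⋯V_{k-1}) ≤ min π (Σ_{i<k} φ(V_i))`. -/
theorem ang_oprod_le (V : ℕ → Matrix.specialUnitaryGroup (Fin 2) ℂ) (k : ℕ) :
    ang (oprod V k) ≤ min π (∑ i ∈ Finset.range k, ang (V i)) := by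
  induction k with
  | zero => simp [oprod, ang_one, Real.pi_pos.le]
  | succ k ih =>
    rw [oprod, Finset.sum_range_succ]
    refine (ang_mul_le _ _).trans ?_
    refine le_min (min_le_left _ _) ?_
    calc min π (ang (oprod V k) + ang (V k)) ≤ ang (oprod V k) + ang (V k) := min_le_right _ _
      _ ≤ _ := by
        have hk := ang_nonneg (V k)
        rcases le_total π (∑ i ∈ Finset.range k, ang (V i)) with hcase | hcase
        · -- then min = π and ang(oprod) ≤ π ≤ sum
          rw [min_eq_left hcase] at ih
          linarith
        · rw [min_eq_right hcase] at ih
          linarith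

/-- If the ordered product is `-1`, the angles sum to at least `π`. -/
theorem pi_le_sum_ang (V : ℕ → Matrix.specialUnitaryGroup (Fin 2) ℂ) (k : ℕ)
    (h : ((oprod V k : Matrix.specialUnitaryGroup (Fin 2) ℂ) : Matrix (Fin 2) (Fin 2) ℂ) = -1) :
    π ≤ ∑ i ∈ Finset.range k, ang (V i) := by
  have hang : ang (oprod V k) = π := by
    simp [ang, h, Real.arccos_neg_one]
  have := ang_oprod_le V k
  rw [hang] at this
  by_contra hlt
  rw [not_le] at hlt
  rw [min_eq_right hlt.le] at this
  linarith


/-- Jensen step: `L ≥ 5` angles in `[0, π]` summing to at least `π` have `Σ cos θ_i ≤ L cos(π/L)`. -/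
theorem sum_cos_le (L : ℕ) (hL : 5 ≤ L) (θ : ℕ → ℝ) (h0 : ∀ i, 0 ≤ θ i) (hπ : ∀ i, θ i ≤ π)
    (hsum : π ≤ ∑ i ∈ Finset.range L, θ i) :
    ∑ i ∈ Finset.range L, Real.cos (θ i) ≤ L * Real.cos (π / L) := by
  have hL0 : (0 : ℝ) < L := by exact_mod_cast (show 0 < L by omega)
  have hL5 : (5 : ℝ) ≤ L := by exact_mod_cast hL
  by_cases hall : ∀ i ∈ Finset.range L, θ i ≤ π / 2
  · have hconc : ConcaveOn ℝ (Set.Icc (-(π / 2)) (π / 2)) Real.cos := strictConcaveOn_cos_Icc.concaveOn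
    have hw : ∑ _i ∈ Finset.range L, (1 : ℝ) / L = 1 := by
      rw [Finset.sum_const, Finset.card_range, nsmul_eq_mul]; field_simp
    have hJ := hconc.le_map_sum (t := Finset.range L) (w := fun _ => (1 : ℝ) / L) (p := θ)
      (fun i _ => by positivity) hw
      (fun i hi => ⟨by linarith [h0 i, Real.pi_pos], hall i hi⟩)
    simp only [smul_eq_mul] at hJ
    rw [← Finset.mul_sum, ← Finset.mul_sum] at hJ
    have hmean_ge : π / L ≤ 1 / L * ∑ i ∈ Finset.range L, θ i := by
      rw [div_eq_mul_one_div, mul_comm]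
      exact mul_le_mul_of_nonneg_left hsum (by positivity)
    have hsumle : ∑ i ∈ Finset.range L, θ i ≤ L * (π / 2) := by
      calc ∑ i ∈ Finset.range L, θ i ≤ ∑ _i ∈ Finset.range L, π / 2 := Finset.sum_le_sum hall
        _ = L * (π / 2) := by rw [Finset.sum_const, Finset.card_range, nsmul_eq_mul]
    have hmean_le : 1 / L * ∑ i ∈ Finset.range L, θ i ≤ π / 2 := by
      rw [one_div, inv_mul_le_iff₀ hL0]; exact hsumle
    have hcos : Real.cos (1 / L * ∑ i ∈ Finset.range L, θ i) ≤ Real.cos (π / L) :=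
      Real.cos_le_cos_of_nonneg_of_le_pi (by positivity) (hmean_le.trans (by linarith [Real.pi_pos]))
        hmean_ge
    have : 1 / L * ∑ i ∈ Finset.range L, Real.cos (θ i) ≤ Real.cos (π / L) := hJ.trans hcos
    rwa [one_div, inv_mul_le_iff₀ hL0] at this
  · push Not at hall
    obtain ⟨k, hk, hkgt⟩ := hall
    have hcosk : Real.cos (θ k) < 0 :=
      Real.cos_neg_of_pi_div_two_lt_of_lt hkgt (by linarith [hπ k, Real.pi_pos])
    have h1 : ∑ i ∈ Finset.range L, Real.cos (θ i) ≤ Real.cos (θ k) + ((L : ℝ) - 1) := by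
      rw [← Finset.add_sum_erase _ _ hk]
      refine add_le_add le_rfl ?_
      calc ∑ i ∈ (Finset.range L).erase k, Real.cos (θ i)
          ≤ ∑ _i ∈ (Finset.range L).erase k, (1 : ℝ) := Finset.sum_le_sum fun i _ => Real.cos_le_one _
        _ = ((L : ℝ) - 1) := by
          rw [Finset.sum_const, Finset.card_erase_of_mem hk, Finset.card_range, nsmul_eq_mul, mul_one]
          push_cast [Nat.one_le_iff_ne_zero.mpr (by omega : L ≠ 0)]
          ring
    have h2 : (L : ℝ) - 1 ≤ L * Real.cos (π / L) := by
      have hc := Real.one_sub_sq_div_two_le_cos (x := π / L)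
      have hpi : π < 3.15 := Real.pi_lt_d2
      have hx : (π / L) ^ 2 / 2 ≤ 1 / L := by
        rw [div_pow, div_div, div_le_div_iff₀ (by positivity) hL0]
        have hpi2 : π ^ 2 < 10 := by nlinarith [Real.pi_pos]
        nlinarith
      calc (L : ℝ) - 1 = L * (1 - 1 / L) := by field_simp
        _ ≤ L * (1 - (π / L) ^ 2 / 2) := by gcongr
        _ ≤ L * Real.cos (π / L) := by gcongr
    linarith


/-! ### The spread toron and its minimality -/


/-- The crux's slice Coulomb functional `coul(U,h) = −Σ_{e spatial, t=0} Re tr ρ((U^h)_e)` (its `let coul`,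
verbatim). -/
def coul {G : Type} [Group G] [TopologicalSpace G] (r : LatticeRep G) (S : ℕ)
    (U : GaugeConfig 4 (2 * S + 1) G) (h : Site 4 (2 * S + 1) → G) : ℝ :=
  -∑ e : Edge 4 (2 * S + 1),
    (if e.1 0 = 0 ∧ e.2 ≠ 0 then (r.ρ (gaugeTransform h U e)).trace.re else 0)

/-- The angle `π / (2S+1)`. -/
def thetaL (S : ℕ) : ℝ := π / (2 * S + 1 : ℝ)

/-- The diagonal entries `(e^{iπ/L}, e^{-iπ/L})` of the spread toron link. -/
def omegaVec (S : ℕ) : Fin 2 → ℂ :=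
  ![Complex.exp ((thetaL S : ℂ) * Complex.I), Complex.exp (-((thetaL S : ℂ) * Complex.I))]

/-- The diagonal entries are unimodular. -/
theorem omegaVec_mul_conj (S : ℕ) (i : Fin 2) : omegaVec S i * conj (omegaVec S i) = 1 := by
  have key : ∀ z : ℂ, z.re = 0 → Complex.exp z * conj (Complex.exp z) = 1 := by
    intro z hz
    rw [← Complex.exp_conj, ← Complex.exp_add, Complex.add_conj, hz]
    simp
  fin_cases i
  · exact key _ (by simp)
  · exact key _ (by simp)

/-- The spread toron link `ω = diag(e^{iπ/L}, e^{-iπ/L}) ∈ SU(2)`. -/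
def omegaL (S : ℕ) : SU2 :=
  ⟨Matrix.diagonal (omegaVec S), by
    rw [Matrix.mem_specialUnitaryGroup_iff, Matrix.mem_unitaryGroup_iff]
    refine ⟨?_, ?_⟩
    · rw [Matrix.star_eq_conjTranspose, Matrix.diagonal_conjTranspose, Matrix.diagonal_mul_diagonal,
        ← Matrix.diagonal_one]
      congr 1
      funext i
      simp [omegaVec_mul_conj]
    · rw [Matrix.det_diagonal, Fin.prod_univ_two]
      simp only [omegaVec, Matrix.cons_val_zero, Matrix.cons_val_one, Matrix.cons_val_fin_one]
      rw [← Complex.exp_add, add_neg_cancel, Complex.exp_zero]⟩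

/-- The matrix of `ω`. -/
@[simp] theorem omegaL_val (S : ℕ) : (omegaL S : Matrix (Fin 2) (Fin 2) ℂ) = Matrix.diagonal (omegaVec S) :=
  rfl

/-- `ω^L = −1`. -/
theorem omegaL_pow_val (S : ℕ) :
    ((omegaL S ^ (2 * S + 1) : SU2) : Matrix (Fin 2) (Fin 2) ℂ) = -1 := by
  rw [SubmonoidClass.coe_pow, omegaL_val, Matrix.diagonal_pow, ← Matrix.diagonal_one,
    Matrix.diagonal_neg]
  congr 1
  have hne : (2 * (S : ℂ) + 1) ≠ 0 := by exact_mod_cast (show (2 * S + 1 : ℕ) ≠ 0 by omega)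
  have hL : ((2 * S + 1 : ℕ) : ℂ) * ((thetaL S : ℝ) : ℂ) = π := by
    simp only [thetaL]; push_cast; field_simp [hne]
  funext i
  fin_cases i
  · show Complex.exp ((thetaL S : ℂ) * Complex.I) ^ (2 * S + 1) = -1
    rw [← Complex.exp_nat_mul, ← mul_assoc, hL, Complex.exp_pi_mul_I]
  · show Complex.exp (-((thetaL S : ℂ) * Complex.I)) ^ (2 * S + 1) = -1
    rw [← Complex.exp_nat_mul, mul_neg, ← mul_assoc, hL, Complex.exp_neg, Complex.exp_pi_mul_I]
    norm_num

/-- `Re tr ω = 2 cos(π/L)`. -/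
theorem re_trace_omegaL (S : ℕ) :
    ((omegaL S : Matrix (Fin 2) (Fin 2) ℂ)).trace.re = 2 * Real.cos (thetaL S) := by
  rw [omegaL_val, Matrix.trace_diagonal, Fin.sum_univ_two]
  simp only [omegaVec, Matrix.cons_val_zero, Matrix.cons_val_one, Matrix.cons_val_fin_one,
    Complex.add_re]
  rw [Complex.exp_ofReal_mul_I_re,
    show -((thetaL S : ℂ) * Complex.I) = ((-thetaL S : ℝ) : ℂ) * Complex.I by push_cast; ring,
    Complex.exp_ofReal_mul_I_re, Real.cos_neg]
  ring

/-- **The spread toron**: every direction-`1` link of the four-torus equals `ω`, all other links `1`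
(flat; holonomy `−1` around every `1`-cycle). -/
def toron (S : ℕ) : GaugeConfig 4 (2 * S + 1) SU2 := fun e => if e.2 = 1 then omegaL S else 1

/-- The trace of the fundamental representation, with the index type normalised to `Fin 2`. -/
theorem su2Fund_trace_re (g : SU2) :
    (su2Fund.ρ g).trace.re = ((g : Matrix (Fin 2) (Fin 2) ℂ)).trace.re := rfl

/-- For `V ∈ SU(2)`, `Re tr V = 2 Re V₀₀`. -/
theorem re_trace_su2 (V : SU2) :
    ((V : Matrix (Fin 2) (Fin 2) ℂ)).trace.re = 2 * ((V : Matrix (Fin 2) (Fin 2) ℂ) 0 0).re := by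
  rw [Matrix.trace_fin_two, su2_apply_11, Complex.add_re, Complex.conj_re]; ring

/-- For `V ∈ SU(2)`, `Re tr V ≤ 2`. -/
theorem re_trace_su2_le (V : SU2) : ((V : Matrix (Fin 2) (Fin 2) ℂ)).trace.re ≤ 2 := by
  rw [re_trace_su2]; linarith [re_le_one V]

/-- `Re tr 1 = 2` in `SU(2)`. -/
theorem re_trace_one_su2 : (((1 : SU2) : Matrix (Fin 2) (Fin 2) ℂ)).trace.re = 2 := by
  rw [OneMemClass.coe_one, Matrix.trace_one]; simp

/-- The gauge transformation by `1` is the identity. -/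
theorem gaugeTransform_one' {G : Type} [Group G] {d L : ℕ} (U : GaugeConfig d L G) :
    gaugeTransform 1 U = U := by
  funext e; simp [gaugeTransform]

/-- The spatial-slice edge sum as a site sum over the three spatial directions. -/
theorem sum_sliceEdges (F : Edge 4 (2 * S + 1) → ℝ) :
    ∑ e : Edge 4 (2 * S + 1), (if e.1 0 = 0 ∧ e.2 ≠ 0 then F e else 0) =
      ∑ x : Site 4 (2 * S + 1), (if x 0 = 0 then F (x, 1) + F (x, 2) + F (x, 3) else 0) := by
  rw [Fintype.sum_prod_type]
  refine Finset.sum_congr rfl fun x _ => ?_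
  rw [Fin.sum_univ_four]
  by_cases hx : x 0 = 0
  · simp [hx, show (1 : Fin 4) ≠ 0 by decide, show (2 : Fin 4) ≠ 0 by decide,
      show (3 : Fin 4) ≠ 0 by decide]
  · simp [hx]

/-- A sum over `ZMod (2S+1)` as a sum over `range (2S+1)` through the cast `ℕ → ZMod`. -/
theorem sum_zmod_eq_sum_range (f : ZMod (2 * S + 1) → ℝ) :
    ∑ n : ZMod (2 * S + 1), f n = ∑ i ∈ Finset.range (2 * S + 1), f (i : ℕ) := by
  calc ∑ n : ZMod (2 * S + 1), f n
      = ∑ n : ZMod (2 * S + 1), f ((n.val : ℕ) : ZMod (2 * S + 1)) := by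
        simp only [ZMod.natCast_zmod_val]
    _ = ∑ i ∈ Finset.range (2 * S + 1), f (i : ℕ) :=
        Fin.sum_univ_eq_sum_range (fun i => f (i : ℕ)) (2 * S + 1)

/-- Reindex a sum over the time-zero slice by (transverse coordinates, position along direction 1). -/
theorem sum_slice_lines (G : Site 4 (2 * S + 1) → ℝ) :
    ∑ x : Site 4 (2 * S + 1), (if x 0 = 0 then G x else 0) =
      ∑ z : Fin 2 → ZMod (2 * S + 1), ∑ i ∈ Finset.range (2 * S + 1),
        G (Fin.cons 0 (Fin.cons ((i : ℕ) : ZMod (2 * S + 1)) z)) := by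
  have h1 : ∑ x : Site 4 (2 * S + 1), (if x 0 = 0 then G x else 0) =
      ∑ p : ZMod (2 * S + 1) × (Fin 3 → ZMod (2 * S + 1)),
        (if p.1 = 0 then G (Fin.cons p.1 p.2) else 0) := by
    rw [← Equiv.sum_comp (Fin.consEquiv fun _ : Fin 4 => ZMod (2 * S + 1))]
    rfl
  have h2 : ∑ p : ZMod (2 * S + 1) × (Fin 3 → ZMod (2 * S + 1)),
        (if p.1 = 0 then G (Fin.cons p.1 p.2) else 0) =
      ∑ y : Fin 3 → ZMod (2 * S + 1), G (Fin.cons 0 y) := by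
    rw [Fintype.sum_prod_type]
    simp only [Finset.sum_ite_irrel, Finset.sum_const_zero, Finset.sum_ite_eq', Finset.mem_univ,
      if_true]
  have h3 : ∑ y : Fin 3 → ZMod (2 * S + 1), G (Fin.cons 0 y) =
      ∑ p : ZMod (2 * S + 1) × (Fin 2 → ZMod (2 * S + 1)), G (Fin.cons 0 (Fin.cons p.1 p.2)) := by
    rw [← Equiv.sum_comp (Fin.consEquiv fun _ : Fin 3 => ZMod (2 * S + 1))]
    rfl
  rw [h1, h2, h3, Fintype.sum_prod_type, Finset.sum_comm]
  exact Finset.sum_congr rfl fun z _ => sum_zmod_eq_sum_range (fun n => G (Fin.cons 0 (Fin.cons n z)))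

/-- The site on the line `z` at position `n` along direction `1`, time zero. -/
def lineSite (z : Fin 2 → ZMod (2 * S + 1)) (n : ZMod (2 * S + 1)) : Site 4 (2 * S + 1) :=
  Fin.cons 0 (Fin.cons n z)

/-- Shifting a line site in direction `1` moves one step along the line. -/
theorem lineSite_shift (z : Fin 2 → ZMod (2 * S + 1)) (n : ZMod (2 * S + 1)) :
    (lineSite z n).shift 1 = lineSite z (n + 1) := by
  rw [shift_one_eq_update]
  simp only [lineSite]
  rw [show (1 : Fin 4) = (0 : Fin 3).succ from rfl, Fin.cons_succ, ← Fin.cons_update, Fin.cons_zero,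
    Fin.update_cons_zero]

/-- Along direction 1 the gauge-transformed toron link at `lineSite z n` is `h(n) ω h(n+1)⁻¹`. -/
theorem gaugeTransform_toron_one (h : Site 4 (2 * S + 1) → SU2) (z : Fin 2 → ZMod (2 * S + 1))
    (n : ZMod (2 * S + 1)) :
    gaugeTransform h (toron S) (lineSite z n, 1) = h (lineSite z n) * omegaL S * (h (lineSite z (n + 1)))⁻¹ := by
  simp only [gaugeTransform, toron, if_true, lineSite_shift]

/-- The chain of transformed direction-1 links along the line `z`, indexed by `ℕ`. -/
def lineChain (h : Site 4 (2 * S + 1) → SU2) (z : Fin 2 → ZMod (2 * S + 1)) (i : ℕ) : SU2 :=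
  h (lineSite z (i : ZMod (2 * S + 1))) * omegaL S * (h (lineSite z ((i : ZMod (2 * S + 1)) + 1)))⁻¹

/-- Telescoping: `W₀ ⋯ W_{k-1} = h(0) ω^k h(k)⁻¹`. -/
theorem oprod_lineChain (h : Site 4 (2 * S + 1) → SU2) (z : Fin 2 → ZMod (2 * S + 1)) (k : ℕ) :
    oprod (lineChain h z) k = h (lineSite z 0) * omegaL S ^ k * (h (lineSite z (k : ZMod (2 * S + 1))))⁻¹ := by
  induction k with
  | zero => simp [oprod]
  | succ k ih =>
    rw [oprod, ih, lineChain, pow_succ]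
    push_cast
    group

/-- Around the torus the chain multiplies to `−1`. -/
theorem oprod_lineChain_full (h : Site 4 (2 * S + 1) → SU2) (z : Fin 2 → ZMod (2 * S + 1)) :
    ((oprod (lineChain h z) (2 * S + 1) : SU2) : Matrix (Fin 2) (Fin 2) ℂ) = -1 := by
  rw [oprod_lineChain, ZMod.natCast_self]
  rw [Submonoid.coe_mul, Submonoid.coe_mul, omegaL_pow_val]
  rw [Matrix.mul_neg, Matrix.mul_one, Matrix.neg_mul, ← Submonoid.coe_mul, mul_inv_cancel]
  rfl

/-- **Line bound**: along every line the transformed direction-1 links of the toron have total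
`Re tr` at most `L · 2cos(π/L)` — the value attained by `h = 1`. -/
theorem sum_line_le (hS : 2 ≤ S) (h : Site 4 (2 * S + 1) → SU2) (z : Fin 2 → ZMod (2 * S + 1)) :
    (∑ i ∈ Finset.range (2 * S + 1),
      (su2Fund.ρ (gaugeTransform h (toron S) (lineSite z ((i : ℕ) : ZMod (2 * S + 1)), 1))).trace.re)
      ≤ (2 * S + 1 : ℝ) * (2 * Real.cos (thetaL S)) := by
  have hL5 : 5 ≤ 2 * S + 1 := by omega
  have hchain : ∀ i : ℕ, gaugeTransform h (toron S) (lineSite z ((i : ℕ) : ZMod (2 * S + 1)), 1) =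
      lineChain h z i := fun i => by rw [gaugeTransform_toron_one]; rfl
  simp only [hchain, su2Fund_trace_re, re_trace_su2, ← cos_ang]
  rw [← Finset.mul_sum]
  have hang := sum_cos_le (2 * S + 1) hL5 (fun i => ang (lineChain h z i)) (fun i => ang_nonneg _)
    (fun i => ang_le_pi _) (pi_le_sum_ang _ _ (oprod_lineChain_full h z))
  have : ((2 * S + 1 : ℕ) : ℝ) = (2 * S + 1 : ℝ) := by push_cast; ring
  rw [this] at hang
  have hθ : thetaL S = π / (2 * (S : ℝ) + 1) := rfl
  rw [hθ]
  linarith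

/-- **The spread toron is an absolute minimiser of its slice Coulomb functional at `h = 1`**
(`S ≥ 2`): for every gauge transformation `h`, `coul(T, 1) ≤ coul(T, h)`. Directions 2, 3 are
term-wise optimal (`Re tr ≤ 2`); direction 1 is optimal line by line (`sum_line_le`: the ordered
product of the transformed links around a `1`-cycle is conjugate to `ω^L = −1`, so their rotation
angles sum to `≥ π`, and `Σ cos θ_i ≤ L cos(π/L)` by concavity). -/
theorem coul_toron_one_le (hS : 2 ≤ S) (h : Site 4 (2 * S + 1) → SU2) :
    coul su2Fund S (toron S) 1 ≤ coul su2Fund S (toron S) h := by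
  unfold coul
  rw [neg_le_neg_iff, sum_sliceEdges, sum_sliceEdges]
  -- split the three directions
  have hsplit : ∀ (P : Site 4 (2 * S + 1) → Prop) [DecidablePred P] (a b c : Site 4 (2 * S + 1) → ℝ),
      ∑ x, (if P x then a x + b x + c x else 0) =
        (∑ x, if P x then a x else 0) + (∑ x, if P x then b x else 0) + ∑ x, if P x then c x else 0 := by
    intro P _ a b c
    rw [← Finset.sum_add_distrib, ← Finset.sum_add_distrib]
    refine Finset.sum_congr rfl fun x _ => ?_
    split_ifs <;> simp
  rw [hsplit, hsplit]
  refine add_le_add (add_le_add ?_ ?_) ?_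
  · -- direction 1: line by line
    rw [sum_slice_lines, sum_slice_lines]
    refine Finset.sum_le_sum fun z _ => ?_
    refine (sum_line_le hS h z).trans (le_of_eq ?_)
    rw [Finset.sum_congr rfl fun i _ => by rw [gaugeTransform_one']]
    simp only [toron, if_true, su2Fund_trace_re, re_trace_omegaL, Finset.sum_const, Finset.card_range,
      nsmul_eq_mul]
    push_cast; ring
  · refine Finset.sum_le_sum fun x _ => ?_
    split_ifs
    · rw [gaugeTransform_one']
      simp only [toron, show (2 : Fin 4) ≠ 1 by decide, if_false, su2Fund_trace_re]
      exact (re_trace_su2_le _).trans (le_of_eq re_trace_one_su2.symm)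
    · exact le_rfl
  · refine Finset.sum_le_sum fun x _ => ?_
    split_ifs
    · rw [gaugeTransform_one']
      simp only [toron, show (3 : Fin 4) ≠ 1 by decide, if_false, su2Fund_trace_re]
      exact (re_trace_su2_le _).trans (le_of_eq re_trace_one_su2.symm)
    · exact le_rfl



/-! ### The toron's zero-momentum covariance and the refuted configuration-wise strengthening -/

/-- The `(0,0)` entry of `ω` is `e^{iπ/L}`. -/
theorem omegaL_val_zero_zero (S : ℕ) :
    (omegaL S : Matrix (Fin 2) (Fin 2) ℂ) 0 0 = Complex.exp ((thetaL S : ℂ) * Complex.I) := by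
  rw [omegaL_val, Matrix.diagonal_apply_eq]; rfl

/-- `sin(π/L) ≥ 2/L` (Jordan), in the form `2 ≤ L sin(π/L)`. -/
theorem two_le_mul_sin_thetaL (hS : 1 ≤ S) : 2 ≤ (2 * S + 1 : ℝ) * Real.sin (thetaL S) := by
  have hL : (3 : ℝ) ≤ 2 * S + 1 := by norm_cast; omega
  have hθ0 : 0 ≤ thetaL S := by unfold thetaL; positivity
  have hθ1 : thetaL S ≤ π / 2 := by
    unfold thetaL
    rw [div_le_div_iff_of_pos_left Real.pi_pos (by positivity) (by norm_num)]
    linarith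
  have hj := Real.mul_le_sin hθ0 hθ1
  have hval : (2 * S + 1 : ℝ) * (2 / π * thetaL S) = 2 := by
    unfold thetaL; field_simp
  calc (2 : ℝ) = (2 * S + 1 : ℝ) * (2 / π * thetaL S) := hval.symm
    _ ≤ (2 * S + 1 : ℝ) * Real.sin (thetaL S) := mul_le_mul_of_nonneg_left hj (by positivity)

/-- **Tightness at `p = 0`, configuration-wise**: the spread toron in the gauge `h = 1` (an ABSOLUTE
Coulomb minimiser, `coul_toron_one_le`) has zero-momentum integrand `≥ 4 (2S+1)` (exactly
`2 L³ sin²(π/L) ≈ 2π² L`). -/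
theorem le_cov_toron (hS : 1 ≤ S) : 4 * (2 * S + 1 : ℝ) ≤ cov su2Fund S (toron S) 1 0 := by
  unfold cov
  simp only [phase_zero, one_smul, su2Fund_ρ, gaugeTransform_one']
  have hω : ∀ y : Fin 3 → ZMod (2 * S + 1), toron S (Fin.cons (0 : ZMod (2 * S + 1)) y, (0 : Fin 3).succ) =
      omegaL S := fun y => by simp [toron]
  set M : Matrix (Fin 2) (Fin 2) ℂ := ∑ y : Fin 3 → ZMod (2 * S + 1),
    (1 / 2 : ℂ) • (((toron S (Fin.cons (0 : ZMod (2 * S + 1)) y, (0 : Fin 3).succ) : SU2) :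
      Matrix (Fin 2) (Fin 2) ℂ) -
      (((toron S (Fin.cons (0 : ZMod (2 * S + 1)) y, (0 : Fin 3).succ) : SU2) :
        Matrix (Fin 2) (Fin 2) ℂ))ᴴ) with hM
  have hfro_nonneg : ∀ j : Fin 3, 0 ≤ fro (∑ y : Fin 3 → ZMod (2 * S + 1),
      (1 / 2 : ℂ) • (((toron S (Fin.cons (0 : ZMod (2 * S + 1)) y, j.succ) : SU2) :
        Matrix (Fin 2) (Fin 2) ℂ) -
        (((toron S (Fin.cons (0 : ZMod (2 * S + 1)) y, j.succ) : SU2) :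
          Matrix (Fin 2) (Fin 2) ℂ))ᴴ)) := fun j => by
    unfold fro; positivity
  have hsum : fro M ≤ ∑ j : Fin 3, fro (∑ y : Fin 3 → ZMod (2 * S + 1),
      (1 / 2 : ℂ) • (((toron S (Fin.cons (0 : ZMod (2 * S + 1)) y, j.succ) : SU2) :
        Matrix (Fin 2) (Fin 2) ℂ) -
        (((toron S (Fin.cons (0 : ZMod (2 * S + 1)) y, j.succ) : SU2) :
          Matrix (Fin 2) (Fin 2) ℂ))ᴴ)) :=
    Finset.single_le_sum (f := fun j : Fin 3 => fro (∑ y : Fin 3 → ZMod (2 * S + 1),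
      (1 / 2 : ℂ) • (((toron S (Fin.cons (0 : ZMod (2 * S + 1)) y, j.succ) : SU2) :
        Matrix (Fin 2) (Fin 2) ℂ) -
        (((toron S (Fin.cons (0 : ZMod (2 * S + 1)) y, j.succ) : SU2) :
          Matrix (Fin 2) (Fin 2) ℂ))ᴴ))) (fun j _ => hfro_nonneg j) (Finset.mem_univ 0)
  have hentry : ‖M 0 0‖ ^ 2 ≤ fro M := by
    unfold fro
    calc ‖M 0 0‖ ^ 2 ≤ ∑ b : Fin 2, ‖M 0 b‖ ^ 2 :=
          Finset.single_le_sum (f := fun b : Fin 2 => ‖M 0 b‖ ^ 2) (fun b _ => by positivity)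
            (Finset.mem_univ 0)
      _ ≤ ∑ a : Fin 2, ∑ b : Fin 2, ‖M a b‖ ^ 2 :=
          Finset.single_le_sum (f := fun a : Fin 2 => ∑ b : Fin 2, ‖M a b‖ ^ 2)
            (fun a _ => by positivity) (Finset.mem_univ 0)
  have hcardR : (Fintype.card (Fin 3 → ZMod (2 * S + 1)) : ℝ) = (2 * S + 1 : ℝ) ^ 3 := by
    rw [Fintype.card_fun, ZMod.card, Fintype.card_fin]; push_cast; ring
  have hM00 : M 0 0 = ((2 * S + 1 : ℝ) ^ 3 : ℝ) * (Complex.I * (Real.sin (thetaL S) : ℂ)) := by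
    rw [hM, Matrix.sum_apply]
    simp_rw [half_sub_conjTranspose_apply_zero, hω, omegaL_val_zero_zero, Complex.exp_ofReal_mul_I_im]
    rw [Finset.sum_const, Finset.card_univ, nsmul_eq_mul, ← hcardR]
    push_cast; ring
  have hsin : 0 ≤ Real.sin (thetaL S) := by
    refine Real.sin_nonneg_of_nonneg_of_le_pi (by unfold thetaL; positivity) ?_
    unfold thetaL
    rw [div_le_iff₀ (by positivity)]
    nlinarith [Real.pi_pos, (show (1 : ℝ) ≤ 2 * S + 1 by norm_cast; omega)]
  have hnorm : ‖M 0 0‖ = (2 * S + 1 : ℝ) ^ 3 * Real.sin (thetaL S) := by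
    rw [hM00, norm_mul, norm_mul, Complex.norm_I, one_mul, Complex.norm_real, Complex.norm_real,
      Real.norm_eq_abs, Real.norm_eq_abs, abs_of_nonneg (by positivity), abs_of_nonneg hsin]
  have h2 := two_le_mul_sin_thetaL hS
  have key : 4 * (2 * S + 1 : ℝ) * (2 * S + 1 : ℝ) ^ 3 ≤ ((2 * S + 1 : ℝ) ^ 3 * Real.sin (thetaL S)) ^ 2 := by
    have hL0 : (0 : ℝ) ≤ 2 * S + 1 := by positivity
    have h4 : (4 : ℝ) ≤ ((2 * S + 1 : ℝ) * Real.sin (thetaL S)) ^ 2 := by nlinarith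
    calc 4 * (2 * S + 1 : ℝ) * (2 * S + 1 : ℝ) ^ 3 = (2 * S + 1 : ℝ) ^ 4 * 4 := by ring
      _ ≤ (2 * S + 1 : ℝ) ^ 4 * ((2 * S + 1 : ℝ) * Real.sin (thetaL S)) ^ 2 :=
          mul_le_mul_of_nonneg_left h4 (by positivity)
      _ = ((2 * S + 1 : ℝ) ^ 3 * Real.sin (thetaL S)) ^ 2 := by ring
  rw [le_div_iff₀ (by positivity)]
  calc 4 * (2 * S + 1 : ℝ) * (2 * S + 1 : ℝ) ^ 3 ≤ ((2 * S + 1 : ℝ) ^ 3 * Real.sin (thetaL S)) ^ 2 := key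
    _ = ‖M 0 0‖ ^ 2 := by rw [hnorm]
    _ ≤ fro M := hentry
    _ ≤ _ := hsum

/-- **Tightness package** (the near-miss `toron_tight` of the work file, now closed): there is `c > 0`
(`c = 4`) such that on every torus `(2S+1)⁴`, `S ≥ 2`, some configuration (`toron S`) has an ABSOLUTE
Coulomb minimiser (`h = 1`) with zero-momentum integrand `≥ c (2S+1)`. So the `p = 0` integrand of the
crux is `≍ L` configuration-wise on the fundamental modular region itself: every proof of
`CovarianceBound` at `p = 0` must average over `U`, and the line's `stub_support` is sharp in `L` there. -/
theorem toron_tight : ∃ c : ℝ, 0 < c ∧ ∀ S : ℕ, 2 ≤ S →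
    ∃ (U : GaugeConfig 4 (2 * S + 1) SU2) (h : Site 4 (2 * S + 1) → SU2),
      (∀ h', coul su2Fund S U h ≤ coul su2Fund S U h') ∧ c * (2 * S + 1 : ℝ) ≤ cov su2Fund S U h 0 :=
  ⟨4, by norm_num, fun S hS => ⟨toron S, 1, coul_toron_one_le hS, le_cov_toron (by omega)⟩⟩

/-- The natural CONFIGURATION-WISE strengthening of the crux: a volume-uniform bound on the supremum
over absolute Coulomb minimisers for EVERY configuration (no Wilson average, so `β` plays no role);
`fro`, `coul`, `cov` and the minimiser subtype are the crux's, verbatim. -/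
def CovarianceBoundPointwise : Prop :=
  ∀ (G : Type) [Group G] [TopologicalSpace G] [IsTopologicalGroup G] [CompactSpace G], IsCompactSimpleLieGroup G → ∀ r : LatticeRep G, ∃ D : ℝ, ∃ S₀ : ℕ, ∀ S : ℕ, S₀ ≤ S → let fro : Matrix (Fin r.N) (Fin r.N) ℂ → ℝ := fun M => ∑ a, ∑ b, ‖M a b‖ ^ 2; let coul : GaugeConfig 4 (2 * S + 1) G → (Site 4 (2 * S + 1) → G) → ℝ := fun U h => -∑ e : Edge 4 (2 * S + 1), (if e.1 0 = 0 ∧ e.2 ≠ 0 then (r.ρ (gaugeTransform h U e)).trace.re else 0); let cov : GaugeConfig 4 (2 * S + 1) G → (Site 4 (2 * S + 1) → G) → (Fin 3 → ZMod (2 * S + 1)) → ℝ := fun U h p => (∑ j : Fin 3, fro (∑ y : Fin 3 → ZMod (2 * S + 1), Complex.exp (-(2 * Real.pi * Complex.I * (∑ i : Fin 3, ((p i).val : ℂ) * ((y i).val : ℂ)) / (2 * S + 1 : ℂ))) • ((1 / 2 : ℂ) • (r.ρ (gaugeTransform h U (Fin.cons (0 : ZMod (2 * S + 1)) y, j.succ))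 - (r.ρ (gaugeTransform h U (Fin.cons (0 : ZMod (2 * S + 1)) y, j.succ)))ᴴ)))) / ((2 * S + 1 : ℝ) ^ 3); ∀ (U : GaugeConfig 4 (2 * S + 1) G) (p : Fin 3 → ZMod (2 * S + 1)), (⨆ h : {h : Site 4 (2 * S + 1) → G // ∀ h', coul U h ≤ coul U h'}, cov U h.1 p) ≤ D

/-- **The configuration-wise strengthening of `CovarianceBound` is FALSE**: the spread torons
`toron S` with their certified absolute minimiser `h = 1` have `sup_{argmin} cov(·,·,0) ≥ 4(2S+1)`,
unbounded in the volume. -/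
theorem not_covarianceBoundPointwise : ¬ CovarianceBoundPointwise := by
  intro H
  obtain ⟨D, S₀, hS₀⟩ := H SU2 isCompactSimpleLieGroup_SU2 su2Fund
  set S : ℕ := max (max S₀ 2) ⌈D⌉₊ with hSdef
  have hS₀S : S₀ ≤ S := le_trans (le_max_left _ _) (le_max_left _ _)
  have h2S : 2 ≤ S := le_trans (le_max_right _ _) (le_max_left _ _)
  have hDS : D ≤ (S : ℝ) := le_trans (Nat.le_ceil D) (by exact_mod_cast le_max_right _ _)
  have h := hS₀ S hS₀S
  have h0 : (⨆ h : {h : Site 4 (2 * S + 1) → SU2 // ∀ h', coul su2Fund S (toron S) h ≤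
      coul su2Fund S (toron S) h'}, cov su2Fund S (toron S) h.1 0) ≤ D := by
    simpa [cov, fro, coul] using h (toron S) 0
  have hbdd : BddAbove (Set.range fun h : {h : Site 4 (2 * S + 1) → SU2 // ∀ h',
      coul su2Fund S (toron S) h ≤ coul su2Fund S (toron S) h'} => cov su2Fund S (toron S) h.1 0) :=
    ⟨12 * ((2 * S + 1 : ℝ) ^ 3) ^ 2, by rintro _ ⟨h, rfl⟩; exact cov_zero_le _ _⟩
  have hsup : cov su2Fund S (toron S) 1 0 ≤ ⨆ h : {h : Site 4 (2 * S + 1) → SU2 // ∀ h',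
      coul su2Fund S (toron S) h ≤ coul su2Fund S (toron S) h'}, cov su2Fund S (toron S) h.1 0 :=
    le_ciSup hbdd ⟨1, coul_toron_one_le h2S⟩
  have hcov := le_cov_toron (S := S) (by omega)
  linarith

/-! ## §B Targets — the six stubs of line `Sketch` (support-slope × response-window), cycle-1 attack log

STUB 2 `SupMeasurable` — TRUE (classical). Existence of minimisers: compactness + continuity (refuter evidence
`coulombMinimisers_nonempty`). Bounds: unitarity. Measurability: the argmin correspondence
`K(U) = ⋂_{h'} {h : coul(U,h) ≤ coul(U,h')}` has closed graph into a compact space, so `U ↦ max_{K(U)} f(U,·)` is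
upper semicontinuous for continuous `f` (Berge), hence Borel; `G` is second countable via `r` so Borel(product) =
`MeasurableSpace.pi`. NOTE the all-gauges analogue is even LOWER semicontinuous (§A `measurable_iSup_cov_zero`).

STUB 3 `SinLeCos` — TRUE (classical). Checked: with `θ = 2π p·a/L`, translation by `(0,a)` maps minimisers to
minimisers and `(Ĉ_j, Ŝ_j) ↦ (cos θ Ĉ_j − sin θ Ŝ_j, cos θ Ŝ_j + sin θ Ĉ_j)` (the `val`-products change by
multiples of `L` inside `cos(2π·/L)`, harmless); `{p·a} = (g) ⊂ ZMod L` has odd order `L' ≥ 3` for `p ≠ 0`, and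
among the angles `2πk/L'` one has `|cos| ≤ 1/2` (`L' = 3`: `cos 120° = −1/2`); translation invariance of
`wilsonMeasure` is the tree's `wilsonMeasure_map_torusConfigShift`.

STUB 4 `ModeReduction` — TRUE (classical). The load-bearing identity `‖Â_j‖²_F = ‖Ĉ_j‖²_F + ‖Ŝ_j‖²_F` holds
EXACTLY, pointwise in `(U,h)`: `Â_j = e^{iφ_j}(Ĉ_j − iŜ_j)` and the cross term is `2 Im tr(Ĉ_j Ŝ_jᴴ)`-type,
which vanishes because `Ĉ, Ŝ` are anti-Hermitian and `tr(CS)` is then real. PROVED below in the form the stub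
needs (`froSum_sub_I_smul_eq`: for anti-Hermitian `C, S`, `Σ_{ab} ‖(C − i S)_{ab}‖² = Σ‖C_{ab}‖² + Σ‖S_{ab}‖²`).
`Ŝ_j(0) = 0` (all phases `sin 0`), `sup(f+g) ≤ sup f + sup g`, the component split and the domination
`X² ≤ L³ cov` are bookkeeping.

STUB 5 `SymmBorelCaratheodory` — TRUE with `κ = 9` (classical). Checked the constants: `g = log(f/2)` on
`‖z‖ < 2R`, `g(0) = 0`, `g'(0) = 0`, `g''(0) = E X²`, `Re g ≤ M‖z‖`; Borel–Carathéodory on `r = R` inside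
`ρ = 1.9R` and Cauchy give `E X² ≤ 4Mρ/(r(ρ−r)) = 8.44… M/R < 9M/R`. Sanity: `X ≡ M` has `f = 2cosh(zM)`, first
zero at `π/(2M)`, so `R ≤ π/(4M)` and `M² ≤ 9M/R` ✓; uniform `X` on `[−M,M]`: first zero `π/M`, `M²/3 ≤ 9M/R` ✓.

STUB 1 `SupportBound` (`cov(U,h,p) ≤ C L³ (p̂² + (2π/L)²)` for EVERY absolute minimiser, `C = C(G,r)`) — OPEN,
not killed. (i) It is contentless for `p̂² ≥ ε₀` (`cov ≤ 3N L³` always); the content is at the `O(L)` lowest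
modes. (ii) `p = 0`, `𝔤`-components: Zwanziger's winding comparison gives `‖Σ_y A_j^{𝔤}(y)‖ ≤ c L²` ✓ consistent.
(iii) `p = 0`, components of `A = ½(ρ − ρᴴ)` OUTSIDE `dρ(𝔤)` (trace part `i Im tr ρ(W)/N` for `SU(N ≥ 3)`; for
`SU(2)` fundamental there are none, `½(W − Wᴴ) ∈ su(2)` exactly): NO minimality principle controls their zero
mode — right multiplication of `h` by centre phases `ω^{n(y)}` (available when `3 ∣ L`, i.e. `S ≡ 1 mod 3`) only
confines `T₁ = Σ_y tr W(y,1)` to the sector `|arg T₁| ≤ π/3`, which allows `Im T₁ ≍ Re T₁ ≍ L³`. So the stub's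
`p = 0` claim `|Σ_y Im tr W(y,j)| ≤ c L²` for all minimisers of all configurations is UNPROTECTED. (iv) Why no
counterexample is filed: every family whose absolute Coulomb minimiser I can certify is flat in two directions
(`U(y,2) = U(y,3) = 1`, `U(y,1) = u(y₁)`); there the 3d problem reduces EXACTLY to the 1d cycle (the transverse
terms force `h` constant in `y₂, y₃` by faithfulness: `Re tr ρ(g) = N ⇒ g = 1`), the 1d optimum spreads the
holonomy uniformly, all eigen-angles of the minimising links are `O(1/L)`, and `Im tr W = −Σ_i φ_i³/6 + … =
O(L⁻³)` per link (`Σ φ_i = 0`): zero-mode trace part `O(1)`, no violation. A counterexample needs a non-flat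
configuration with a CERTIFIED absolute minimiser whose links stay `O(1)` away from `1` with sign-coherent
`Im tr` over a positive fraction of the volume — e.g. a maximally frustrated checkerboard pattern, which the odd
side `2S+1` forbids. Kit-level adversarial search (bilevel: outer ascent on `U`, inner annealed gauge fixing)
cannot certify ABSOLUTE minimisers and was not run. RECOMMENDATION to the stub worker: prove `SupportBound` for
the `dρ(𝔤)`-projection of `A` first (that is what Zwanziger's argument gives) and treat the complement
separately; for `SU(2)` fundamental the complement is empty, so a `G = SU(2), r = fund` version of the whole
line is not exposed to this gap.

STUB 6 `ZeroFreeWindow` — crux-strength (agreeing with the lead), not killed; two NECESSARY features of the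
existential selection `sel`, derived from zero-location asymptotics (heuristic but sharp):
(a) "Polar" frames are fatal. If `sel` rotates the zero mode `Z_j(U) ∈ su(2) ≅ ℝ³` to a fixed axis, the
component is `X = ‖Z_j(U)‖ ≥ 0`; for a Maxwell-type radial law of scale `σ² = E‖Z‖²/3 ≍ L³ D(0)` one has
`E cosh(zX) = (1 + σ²z²) e^{σ²z²/2}` EXACTLY, with zeros at `z = ±i/σ ≍ L^{-3/2}` — inside the window `c·2π/L`
unless `D(0) ≲ 1/L`. (b) Reflection-equivariance is FORCED, not a convenience. For a non-symmetric law with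
extensive third cumulant `κ₃(X) = k₃ L³` the symmetrised transform is
`f(z) ≈ 2 e^{κ₂z²/2} cosh(k₃ L³ z³/6)`, whose first zeros sit at `|z| = (3π/|k₃|)^{1/3} / L` — EXACTLY the window
scale at `p = 0` (and at the momenta with `3p ≡ 0 (mod L)`, which exist whenever `3 ∣ L`, where
`Σ_y cos³(θ_y + φ_j) = (L³/4) cos 3φ_j ≠ 0`); so either `c(β) < (3π/|k₃|)^{1/3}/(2π)` or the law of every
component must be symmetric, i.e. `sel` equivariant under the full spatial reflection (which acts by
`Ĉ ↦ −Ĉ`). A measurable equivariant selection exists (free `ℤ₂`-action a.e., Borel transversal), so this is a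
constraint on the proof, not a refutation. (c) With (a)–(b) respected and weak dependence of the gauge-fixed
slice field (a convergent expansion for `log E e^{zX}`, `|z| < z₀ = O(1)` uniformly in `L`), the window would hold
with radius `O(1) ≫ c(|p̂| + 2π/L)`; the whole difficulty is that the minimal Coulomb gauge is a GLOBAL
optimisation with no known expansion — the crux in Lee–Yang clothing, as PICKED.md says.
-/

/-- Entrywise: `‖c − i s‖² = ‖c‖² + ‖s‖² − 2 Im(c conj s)`. -/
theorem normSq_sub_I_mul (c s : ℂ) :
    ‖c - Complex.I * s‖ ^ 2 = ‖c‖ ^ 2 + ‖s‖ ^ 2 - 2 * (c * conj s).im := by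
  rw [Complex.sq_norm, Complex.sq_norm, Complex.sq_norm, Complex.normSq_apply, Complex.normSq_apply,
    Complex.normSq_apply]
  simp [Complex.mul_im, Complex.mul_re]
  ring

/-- For anti-Hermitian `C, S`, `Σ_{a,b} Im (C_{ab} conj S_{ab}) = 0` (it is `−Im tr(C S)` and `tr(C S)` is real). -/
theorem sum_im_mul_conj_eq_zero {n : ℕ} (C S : Matrix (Fin n) (Fin n) ℂ) (hC : Cᴴ = -C) (hS : Sᴴ = -S) :
    ∑ a, ∑ b, (C a b * conj (S a b)).im = 0 := by
  -- pair the terms (a,b) and (b,a): C_{ba} conj S_{ba} = conj(C_{ab}) S_{ab} = conj (C_{ab} conj S_{ab})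
  have hCe : ∀ a b, C b a = -conj (C a b) := fun a b => by
    have h : conj (C a b) = -C b a := by
      simpa [Matrix.conjTranspose_apply] using congrFun (congrFun hC b) a
    exact neg_eq_iff_eq_neg.mp h.symm
  have hSe : ∀ a b, S b a = -conj (S a b) := fun a b => by
    have h : conj (S a b) = -S b a := by
      simpa [Matrix.conjTranspose_apply] using congrFun (congrFun hS b) a
    exact neg_eq_iff_eq_neg.mp h.symm
  have hsum : ∑ a, ∑ b, (C a b * conj (S a b)).im = ∑ a, ∑ b, (C b a * conj (S b a)).im := by
    rw [Finset.sum_comm]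
  have hneg : ∑ a, ∑ b, (C b a * conj (S b a)).im = -∑ a, ∑ b, (C a b * conj (S a b)).im := by
    rw [← Finset.sum_neg_distrib]
    refine Finset.sum_congr rfl fun a _ => ?_
    rw [← Finset.sum_neg_distrib]
    refine Finset.sum_congr rfl fun b _ => ?_
    rw [hCe a b, hSe a b]
    simp [Complex.mul_im]
    ring
  linarith

/-- **The identity behind `stub_modeReduction` (i):** for anti-Hermitian `C, S` (as the cosine and sine
modes of the anti-Hermitian gluon field are), `Σ_{a,b} ‖(C − i S)_{ab}‖² = Σ_{a,b} ‖C_{ab}‖² + Σ_{a,b} ‖S_{ab}‖²`;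
with `Â_j = e^{iφ_j}(Ĉ_j − iŜ_j)` this is `‖Â_j‖²_F = ‖Ĉ_j‖²_F + ‖Ŝ_j‖²_F`, pointwise in `(U, h)`. -/
theorem froSum_sub_I_smul_eq {n : ℕ} (C S : Matrix (Fin n) (Fin n) ℂ) (hC : Cᴴ = -C) (hS : Sᴴ = -S) :
    ∑ a, ∑ b, ‖(C - Complex.I • S) a b‖ ^ 2 = (∑ a, ∑ b, ‖C a b‖ ^ 2) + ∑ a, ∑ b, ‖S a b‖ ^ 2 := by
  have h0 := sum_im_mul_conj_eq_zero C S hC hS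
  simp only [Matrix.sub_apply, Matrix.smul_apply, smul_eq_mul, normSq_sub_I_mul]
  simp only [Finset.sum_sub_distrib, Finset.sum_add_distrib, ← Finset.mul_sum, h0, mul_zero, sub_zero]

/-! ## §C Load-bearing analysis of the crux's own hypotheses; near-misses

| hypothesis / feature | dropped or mutated | outcome |
|---|---|---|
| `h ∈ argmin coul(U,·)` (FMR) | sup over all `h` | FALSE — §A, landed (`not_covarianceBoundWithoutMinimality`) |
| Wilson average `∫ dμ_β` | bound for EVERY configuration | FALSE — §A′ (`not_covarianceBoundPointwise`): spread torons with certified minimiser `h = 1` give `≥ 4(2S+1)` |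
| `IsCompactSimpleLieGroup G` | any compact `G` with a `LatticeRep` | `G = U(1)`: false in physics (massless photon, `D(p_min) ∝ L/β`), proof = Guth 1980 / Fröhlich–Spencer 1982 deconfinement, out of reach (near-miss `covBody_U1_false`); `G` trivial or finite: TRUE trivially / plausibly (ordered phase) — so NO `_false_without_Simple` theorem; the hypothesis excludes exactly the abelian Coulomb phase |
| faithfulness of `r` | trivial `ρ` | TRUE trivially (`A ≡ 0`) — content, not truth |
| unitarity of `r` | `PρP⁻¹` | bounded distortion, same truth value |
| `∃ S₀`, `0 < D` | `∀ S`, any `D` | DECORATION: each fixed `S` contributes `≤ 3N(2S+1)³`, so `S₀` can be absorbed into `D` (not written out; ~80 lines if wanted) |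
| `β₀ ≤ β` | all `β ≥ 0` | strengthening; at `β = 0` the slice is i.i.d. Haar and the minimal Landau gauge of noise — bounded per ideator-3's toy (j015652), no proof either way |
| `p = 0` included | `p ≠ 0` only | `p = 0` is where torons / the zero mode live; configuration-wise `sup_{argmin} cov(·,·,0) ≥ 4L` ON the fundamental modular region (`toron_tight`, PROVED in §A′), so any proof at `p = 0` averages; the `p ≠ 0` statement is NOT obviously easier (lowest mode `2π/L`) |
| full `½(ρ − ρᴴ)` incl. non-`𝔤` part | `dρ(𝔤)`-projection only | the projection is what gauge fixing controls (§B stub 1 (iii)); for `SU(2)` fundamental no difference |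
-/

/-- NEAR-MISS (why `IsCompactSimpleLieGroup` is there): the crux's body is FALSE for `G = U(1)` (unit circle,
`ρ` = the inclusion, `N = 1`): in the Coulomb phase `β ≥ β_c` the minimal-Coulomb-gauge equal-time photon
covariance at the lowest momentum is `≍ L/(4π β_R)`, unbounded in the volume. OBSTRUCTION: this is the
Guth (1980) / Fröhlich–Spencer (CMP 83 (1982) 411) deconfinement theorem plus control of the compact-`U(1)`
Gribov copies at weak coupling — far beyond the tree. Recorded so that nobody weakens the hypothesis to
"compact connected `G`": the abelian factor is exactly what the hypothesis must exclude (it does: non-abelian +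
quasi-simple). Stated over the tree's `Circle` with its `LatticeRep` left abstract. -/
theorem covBody_U1_false (r : LatticeRep Circle) (hr : r.N = 1) :
    ¬ (∃ β₀ : ℝ, ∀ β : ℝ, β₀ ≤ β → ∃ D : ℝ, 0 < D ∧ ∃ S₀ : ℕ, ∀ S : ℕ, S₀ ≤ S →
      ∀ p : Fin 3 → ZMod (2 * S + 1),
        ∫ U, (⨆ h : {h : Site 4 (2 * S + 1) → Circle // ∀ h',
            (-∑ e : Edge 4 (2 * S + 1), (if e.1 0 = 0 ∧ e.2 ≠ 0 then
              (r.ρ (gaugeTransform h U e)).trace.re else 0)) ≤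
            (-∑ e : Edge 4 (2 * S + 1), (if e.1 0 = 0 ∧ e.2 ≠ 0 then
              (r.ρ (gaugeTransform h' U e)).trace.re else 0))}, cov r S U h.1 p)
          ∂(wilsonMeasure (d := 4) (L := 2 * S + 1) r.ρ β) ≤ D) := by
  sorry

end

end Summit.QuantumFields.YangMills.Cruxes.CovarianceBound.Disproof
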